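import Literature.MathematicalPhysics.QuantumFieldTheory.Balaban1983to89.B4
import Literature.MathematicalPhysics.QuantumFieldTheory.Balaban1983to89.B4GaugeCovariance
import Literature.MathematicalPhysics.QuantumFieldTheory.Balaban1983to89.B4Lower18

/-!
# [B4] (1.8) FOR REGULAR NON-CONSTANT CONFIGURATIONS ON FINE BOXES: the expansion (2.23)–(2.26) about a constant background, at the level of quadratic forms

T. Bałaban, *Regularity and decay of lattice Green's functions*, Commun. Math. Phys. **89** (1983) 571–597
[cite: Balaban1983RegularityDecay] (= [B4]; journal page = PDF page + 570).  Cell unit `b2b-balaban-b04` gen 13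
(claim G-B4-224-LOWER18-REGULAR), written over `B4GaugeCovariance` (this lineage: [B4]'s operator `b4Op` for an
arbitrary link field, its gauge covariance and the reduction of a CONSTANT configuration to zero field) and
`B4Lower18` (the zero-field bound `lower18_zero`, constant `min(2,a)`).  This file is the lineage's first result at
`A ≠ 0`: the positivity (1.8) — and with it the existence and the `L²` bound of the Green's function `G_k(□,A)`,
Lemma 2.1 (2.15) first member — for configurations that are (2.23)-close to a constant one on a fine box, with
EXPLICIT constants, for every `N` (abelian one-generator gauge group `U = exp(eηA·q)`) and every dimension.

## THE PRINTED TEXT (verbatim «…»)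

(1.8), p. 573: «The operator defining the Green's function (1.6) has a strictly positive lower bound. More exactly
we prove that there exists a positive constant γ₀ such that for e sufficiently small and for a regular vector field
A (1.8) −Δ^{η,N}_{A,Ω} + aP_k(A) ≥ γ₀ I. The constant γ₀ is independent of the lattice spacing η, as well as of Ω
and of A.»  Lemma 2.1, p. 577: «Let a set □ be an arbitrary sum of unit blocks, but such that it is a sum of at most
few large blocks, and let A be as in the theorem. Then for e sufficiently small we have (2.15) ‖G_k(□,A)f‖₂,
‖D^η_{A,μ}G_k(□,A)f‖₂, ‖G_k(□,A)D^{η*}_{A,μ}f‖₂, ‖D^η_{A,μ}G_k(□,A)D^{η*}_{A,ν}f‖₂ ≤ c₂‖f‖₂.»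

Proof of Lemma 2.1, pp. 579–580: «We can write the configuration A as a sum A₀ + A', where A₀ is a constant
configuration, e.g. it is a value of A at some point of □, and A' is a small and regular configuration, i.e. we
have (2.23) A = A₀ + A', |A'|, |∂^η_μA'| ≤ c'e^{β−1}, c' depends on c and M. Now we expand the propagator G_k(□,A)
with respect to A'. Using formula I.3.16 we have (2.24) G_k^{1/2}(□,A₀)(−Δ^{η,N}_{A,□} + m_k² +
a_kP_k(A))G_k^{1/2}(□,A₀) = I − G_k^{1/2}(□,A₀)[F_{1,k}(−A')^*D^η_{A₀} + D^{η*}_{A₀}F_{1,k}(−A') −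
F_{1,k}(−A')^*F_{1,k}(−A') − a_kF_{2,k}(A',A₀)^*Q_k(A₀) − a_kQ_k^*(A₀)F_{2,k}(A',A₀) −
a_kF_{2,k}(A',A₀)^*F_{2,k}(A',A₀)]G_k^{1/2}(□,A₀) =: I − G_k^{1/2}(□,A₀)V_kG_k^{1/2}(□,A₀),» «where F_{1,k}(A) =
η^{−1}(U(A) − 1), (F_{2,k}(A',A₀)φ)(y) = Σ_{x∈B^k(y)} η^dF'_{1,k}(A'(Γ^{(k)}_{y,x}))U(A₀(Γ^{(k)}_{y,x}))φ(x), and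
F'_{1,k}(A) = U(A) − 1. Taking into account the bound (2.23) and the inequalities (2.25) ‖G_k^{1/2}(□,A₀)‖_{2,2},
‖D_{A₀}G_k^{1/2}(□,A₀)‖_{2,2}, ‖G_k^{1/2}(□,A₀)D^*_{A₀}‖_{2,2} ≤ c₀, holding for some absolute constant c₀, we can
easily prove that ‖G_k^{1/2}(□,A₀)V_kG_k^{1/2}(□,A₀)‖_{2,2} ≤ O(1)e^β, with a constant O(1) depending on M only.
For e sufficiently small, we get the representation (2.26) G_k(□,A) = G_k^{1/2}(□,A₀)(I −
G_k^{1/2}(□,A₀)V_kG_k^{1/2}(□,A₀))^{−1}G_k^{1/2}(□,A₀),» … «Using the same gauge transformation as in the proof of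
Lemma 2.4, we reduce them to the case A₀ = 0. Now these bounds are consequences of quadratic form considerations.»
And p. 581: «we have the representation (2.26) for e sufficiently small, which we can write in the following form
(2.31) G_k(□,Ã) = Σ_{n=0}^∞ G_k(□,A₀)(V_kG_k(□,A₀))^n.»

## DICTIONARY (as in `B4GaugeCovariance` / `B4Lower18`)

Sites of the fine box `Π_μ [0, n·M_μ) ∩ ℤ^{d+1}` are the points of `ηℤ^{d+1} ∩ □` (`η = 1/n`, `n = L^k`), unit blocks
are indexed by `Π_μ [0, M_μ)`; forms are divided by the common volume factor `η^{d+1}`, so `−Δ^{η,N}` carries the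
weight `n²/2` per ORIENTED nearest-neighbour pair (`boxWt`), `a_kP_k = a·n^{−(d+1)}·Q^*Q` with the block sums `Q`
(`blkWt`, transporters `U(A(Γ_{y,x}))` = `contourTrans`); the link variable is `U(A_b) = F.U(κA_b)` for an
orthogonal one-parameter flow `F` (`OrthFlow`: `U(0) = 1`, `U(s+t) = U(s)U(t)`, `U(t)ᵀU(t) = 1`), `κ = eη = e/n`.

## WHAT IS CERTIFIED (kernel, sorry-free; every hypothesis explicit)

* §1–§3 THE EXPANSION AS EXACT IDENTITIES for arbitrary finite site/block types: `covLap_kmul`, `projOp_kmul`,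
  `covOp_kmul`/`b4Op_add` — (2.24) unsandwiched, `H(A₀ + A') = H(A₀) + [cross terms + F_1-square + a(F_2-terms)]`
  (`vOp`); `covOp_kmul_sandwich` — (2.24) for ANY `S` with `S·H(A₀)·S = 1`; `inv_sub_eq_sandwich` — (2.26);
  `inv_sub_expand` — (2.31) as the FINITE Neumann expansion with remainder (the square root `G_k^{1/2}` and the
  infinite series are not constructed: algebra only); `transport_fieldLink` — `U(A(Γ)) = F.U(κ Σ_{b⊂Γ} A_b)`.
* §4 THE QUADRATIC-FORM PERTURBATION BOUND `covOp_kmul_form_ge(_quarter)`: if the massless background form is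
  `≥ γ₀|Φ|²` and the perturbation factors have sizes `ε₁` (`F_1`, sitewise) and `ε₂` (`F_2`) with `ε₁ + aε₂ ≤ γ₀/4`,
  then `⟨Φ, H(A)Φ⟩ ≥ (γ₀/4 + m²)|Φ|²`; `pertE_form_le`, `pertF_form_le` (Cauchy–Schwarz); `isUnit_det_of_form_ge`,
  `inv_mulVec_sq_le`, `inv_mulVec_dotProduct_le` (Lax–Milgram-type consequences for the inverse).
* §6 ON FINE BOXES: `background_form_ge` — `H(A₀)` massless `≥ min(2,a)` for CONSTANT `A₀` (gauge covariance +
  `lower18_zero`); `pertE_site_bound` (`ε₁ = (d+1)ℓ²θ²`), `pertT_bound` (`|U(κA'(Γ)) − 1| ≤ ℓ(d+1)θ`);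
  **`lower18_regular_box`**: for a Lipschitz flow `|(U(t) − 1)v| ≤ ℓ|t||v|`, `|κ(A − A₀)_b| ≤ θ/n` on
  nearest-neighbour bonds, contours ending at `x`, nearest-neighbour, of length `≤ (d+1)n`, and
  `ℓ²θ²(d+1)(1 + a(d+1)) ≤ min(2,a)/4`:  `⟨Φ, (−Δ^{η,N}_{A,□} + m² + a_kP_k(A))Φ⟩ ≥ (min(2,a)/4 + m²)|Φ|²`.
* §7 THE PRINTED PARAMETRISATION: `lower18_regular_box_charge` (`κ = e/n`, (2.23) `|A'_b| ≤ c'e^{β−1}`,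
  `θ = c'e^β`), `threshold_exists` (an explicit `e₁ > 0` such that the smallness holds for all `0 < e ≤ e₁`),
  `rot_lipschitz` (the flow hypothesis for the rotation flow, `N = 2`, `ℓ = 1`).
* §8 THE STAIRCASE CONTOURS `Γ_{y,x}` (`stair`, `stairContour`: from the corner `n·y` of `B(y)` to `x`, axis by
  axis): they end at `x`, are nearest-neighbour inside the box and have length `≤ (d+1)n`
  (`stairContour_end/_nn/_length`), so **`lower18_regular_box_stair`** has NO contour hypothesis; and
  `green_box_l2_bound`: `G_k(□,A)` exists and `(min(2,a)/4 + m²)²‖G_k(□,A)f‖₂² ≤ ‖f‖₂²` — (2.15), first member.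
* §9 THE TYPED CLAIM: `B4.Claim18Printed` («there exists a positive constant γ₀ such that for e sufficiently small
  and for a regular vector field A (1.8) −Δ^{η,N}_{A,Ω} + aP_k(A) ≥ γ₀ I.», typed `∃ γ₀ e₁ > 0, ∀ i, regular →
  0 < e → e ≤ e₁ → lower18 γ₀`) HOLDS on the regular-box family `regularBoxSetting F a c' β` — instances
  `(n, M, e, A₀, A)` with the instance's OWN charge `e`, `regular` := `|A_b − A₀(b)| ≤ c'e^{β−1}` on nearest-neighbour
  bonds, `lower18 γ` := the form inequality at mass `0` with `κ = e/n` — by `claim18Printed_regularBox`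
  (any Lipschitz flow, `a > 0`, `c' ≥ 0`, `β > 0`) and `claim18Printed_regularBox_rot` (rotation flow; hypotheses
  `a > 0`, `c' ≥ 0`, `β > 0` only).  `regularBoxSetting_regular_iff` / `_lower18_iff` / `_e` display the three fields.

## HONEST SCOPE / DIVERGENCES (recorded in the cell's DIVERGENCES.md)

1. REGION: fine boxes `Π_μ[0, n·M_μ)` only; [B4] states (1.8) for every union `Ω` of big blocks (this needs the
   blockwise decoupling (2.26bis) with blockwise backgrounds, not done here).
2. REGULARITY is typed in the (2.23) form about ONE constant background on the box — what [B4] derives from (1.7)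
   on a big block («c' depends on c and M»); the derivation (1.7) ⇒ (2.23) and the `|∂^η_μA'|` member are not used.
3. CONSTANTS: `γ₀ = min(2,a)/4` (printed: an unspecified `γ₀`; `min(2,a)` is the lineage's zero-field constant —
   cf. the cell's GAPS G-B4-03 on the printed `min{π², a_k}`); `e₁` explicit in `ℓ, c', β, a, d`.
4. METHOD: quadratic forms (Cauchy–Schwarz with weight `t = 1/2`) instead of the operator norm
   `‖G_k^{1/2}V_kG_k^{1/2}‖_{2,2} ≤ O(1)e^β`; (2.24), (2.26), (2.31) are certified as algebraic identities only.
5. FLOW: any orthogonal one-parameter flow with the Lipschitz hypothesis (for `U = exp(tq)`: `ℓ = ‖q‖`), witnessed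
   by the rotation flow; `Matrix.exp` is not used (as in `B4GaugeCovariance`).
6. NOT certified: (2.15) members 2–4, (2.25)/(2.29), Lemma 2.2, Corollary 2.3 and the Theorem (1.9)–(1.12) at `A ≠ 0`.

Value = kernel certificate of the mechanism of a published lemma on an explicit model family; NOT summit progress.
-/

namespace Literature.MathematicalPhysics.QuantumFieldTheory.Balaban1983to89.B4Lower18Regular

open Matrix Finset Kronecker
open Literature.MathematicalPhysics.QuantumFieldTheory.Balaban1983to89.B4GaugeCovariance

section Expansion

variable {X Y ι : Type*}

/-! ## §1 Products of link variables; the perturbation factors `U(A') − 1` -/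

/-- the POINTWISE PRODUCT of two-point kernels: `(K' ⊙ K)(y,x) = K'(y,x)·K(y,x)` ([B4] p. 580: `U(A_b) =
U(A'_b)U(A₀,b)` for `A = A₀ + A'`, and the same for the transporters `U(A(Γ))`). [folklore] -/
def kmul [Fintype ι] (K' K : Y → X → Matrix ι ι ℝ) : Y → X → Matrix ι ι ℝ := fun y x => K' y x * K y x

/-- entries of the pointwise product. [folklore] -/
@[simp] theorem kmul_apply [Fintype ι] (K' K : Y → X → Matrix ι ι ℝ) (y : Y) (x : X) :
    kmul K' K y x = K' y x * K y x := rfl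

/-- THE PERTURBATION MATRIX `E(x,y) = 1 − U(A'_{xy})ᵀ` of a link perturbation `W'` (for [B4]'s flow
`U(A')ᵀ = U(−A')`, so `E = −(U(−A') − 1) = −η·F_{1,k}(−A')` in the notation of p. 580 «where F_{1,k}(A) =
η^{−1}(U(A) − 1)»). [cite: Balaban1983RegularityDecay, p. 580, dictionary] -/
def pertE [DecidableEq ι] (W' : Y → X → Matrix ι ι ℝ) : Y → X → Matrix ι ι ℝ := fun y x => 1 - (W' y x)ᵀ

/-- THE TRANSPORT PERTURBATION `T'(y,x) − 1 = U(A'(Γ_{y,x})) − 1` (`= F'_{1,k}(A'(Γ))` up to `η^{-1}`, p. 580).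
[cite: Balaban1983RegularityDecay, p. 580, dictionary] -/
def pertT [DecidableEq ι] (T' : Y → X → Matrix ι ι ℝ) : Y → X → Matrix ι ι ℝ := fun y x => T' y x - 1

/-- **`D_A = U(A')D_{A₀} + F_1(A')`** ([B4] p. 580 «according to the formula D^η_A = U(A')D^η_{A₀} + F_{1,k}(A')»,
`F_{1,k}` = multiplication by `η^{-1}(U(A'_b) − 1)` at `b₋`): for every pair of link fields,
`D_{W'W₀}(x,y) = W'(x,y)·D_{W₀}(x,y) + (W'(x,y) − 1)·π_x`. [cite: Balaban1983RegularityDecay, p. 580] -/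
theorem bondDiff_kmul [Fintype X] [Fintype ι] [DecidableEq X] [DecidableEq ι] (W' W₀ : X → X → Matrix ι ι ℝ)
    (x y : X) :
    bondDiff (kmul W' W₀) x y
      = blockDiag (fun _ : Unit => W' x y) * bondDiff W₀ x y
        + blockDiag (fun _ : Unit => W' x y - 1) * siteP (ι := ι) x := by
  unfold bondDiff siteP
  rw [blockDiag_mul_blockOp, blockDiag_mul_blockOp, ← blockOp_add]
  congr 1
  funext u z
  simp only [Pi.add_apply, kmul_apply, mul_sub, mul_ite, mul_zero, mul_one]
  split_ifs <;> abel

/-- for an ORTHOGONAL perturbation factor, `D_{W'W₀}(x,y) = W'(x,y)·(D_{W₀}(x,y) + E(x,y)·π_x)` with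
`E = 1 − W'ᵀ`. [folklore] -/
theorem bondDiff_kmul_orth [Fintype X] [Fintype ι] [DecidableEq X] [DecidableEq ι] {W' : X → X → Matrix ι ι ℝ}
    (hW' : ∀ x y, (W' x y)ᵀ * W' x y = 1) (W₀ : X → X → Matrix ι ι ℝ) (x y : X) :
    bondDiff (kmul W' W₀) x y
      = blockDiag (fun _ : Unit => W' x y)
          * (bondDiff W₀ x y + blockDiag (fun _ : Unit => pertE W' x y) * siteP (ι := ι) x) := by
  rw [bondDiff_kmul, Matrix.mul_add, ← Matrix.mul_assoc, blockDiag_mul_blockDiag]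
  congr 3
  funext u
  rw [pertE, Matrix.mul_sub, Matrix.mul_one, mul_eq_one_comm.1 (hW' x y)]

/-- an orthogonal factor on the left drops out of a Gram product: `(𝒪Z)ᵀ(𝒪Z) = ZᵀZ`. [folklore] -/
theorem gram_blockDiag_mul [Fintype X] [Fintype Y] [Fintype ι] [DecidableEq Y] [DecidableEq ι]
    {g : Y → Matrix ι ι ℝ} (hg : IsGauge g) (Z : Matrix (Y × ι) (X × ι) ℝ) :
    (blockDiag g * Z)ᵀ * (blockDiag g * Z) = Zᵀ * Z := by
  rw [Matrix.transpose_mul, Matrix.mul_assoc, ← Matrix.mul_assoc (blockDiag g)ᵀ, blockDiag_transpose_mul_self hg,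
    Matrix.one_mul]

/-! ## §2 THE EXPANSION (2.24) OF `−Δ_A`, `Q_k(A)`, `P_k(A)`, `H(A)` ABOUT A BACKGROUND, AS EXACT OPERATOR
IDENTITIES -/

/-- the CROSS TERM `Σ_{x,y} c(x,y)·D_{W₀}(x,y)ᵀ·E(x,y)π_x` of the expansion of `−Δ` (the printed `−D^*_{A₀}F_1(−A')`
with `c = η^{-2}`, `E = −ηF_1(−A')`). [cite: Balaban1983RegularityDecay, p. 580 (2.24), dictionary] -/
def crossOp [Fintype X] [Fintype ι] [DecidableEq X] [DecidableEq ι] (c : X → X → ℝ)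
    (W₀ E : X → X → Matrix ι ι ℝ) : Matrix (X × ι) (X × ι) ℝ :=
  ∑ x, ∑ y, c x y • ((bondDiff W₀ x y)ᵀ * (blockDiag (fun _ : Unit => E x y) * siteP (ι := ι) x))

/-- the QUADRATIC TERM `Σ_{x,y} c(x,y)·(E(x,y)π_x)ᵀ(E(x,y)π_x)` (the printed `F_1(−A')^*F_1(−A')`).
[cite: Balaban1983RegularityDecay, p. 580 (2.24), dictionary] -/
def quadOp [Fintype X] [Fintype ι] [DecidableEq X] [DecidableEq ι] (c : X → X → ℝ)
    (E : X → X → Matrix ι ι ℝ) : Matrix (X × ι) (X × ι) ℝ :=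
  ∑ x, ∑ y, c x y • ((blockDiag (fun _ : Unit => E x y) * siteP (ι := ι) x)ᵀ
    * (blockDiag (fun _ : Unit => E x y) * siteP (ι := ι) x))

/-- **THE EXPANSION OF `−Δ_A` ABOUT `A₀`** (the Laplacian part of (2.24)): for orthogonal perturbation factors,
`−Δ_{W'W₀} = −Δ_{W₀} + C + Cᵀ + F^*F` with `C = Σ c·D_{W₀}ᵀEπ` and `F^*F = Σ c·(Eπ)ᵀ(Eπ)` — i.e. the printed
`−Δ_A = −Δ_{A₀} − [F_1(−A')^*D_{A₀} + D^*_{A₀}F_1(−A')] + F_1(−A')^*F_1(−A')` read through `E = −ηF_1(−A')`,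
`c = η^{-2}`. [cite: Balaban1983RegularityDecay, p. 580 (2.24)] -/
theorem covLap_kmul [Fintype X] [Fintype ι] [DecidableEq X] [DecidableEq ι] (c : X → X → ℝ)
    {W' : X → X → Matrix ι ι ℝ} (hW' : ∀ x y, (W' x y)ᵀ * W' x y = 1) (W₀ : X → X → Matrix ι ι ℝ) :
    covLap c (kmul W' W₀)
      = covLap c W₀ + crossOp c W₀ (pertE W') + (crossOp c W₀ (pertE W'))ᵀ + quadOp c (pertE W') := by
  have hterm : ∀ x y, (bondDiff (kmul W' W₀) x y)ᵀ * bondDiff (kmul W' W₀) x y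
      = (bondDiff W₀ x y)ᵀ * bondDiff W₀ x y
        + (bondDiff W₀ x y)ᵀ * (blockDiag (fun _ : Unit => pertE W' x y) * siteP (ι := ι) x)
        + (blockDiag (fun _ : Unit => pertE W' x y) * siteP (ι := ι) x)ᵀ * bondDiff W₀ x y
        + (blockDiag (fun _ : Unit => pertE W' x y) * siteP (ι := ι) x)ᵀ
          * (blockDiag (fun _ : Unit => pertE W' x y) * siteP (ι := ι) x) := by
    intro x y
    rw [bondDiff_kmul_orth hW', gram_blockDiag_mul (fun _ => hW' x y), Matrix.transpose_add, Matrix.add_mul,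
      Matrix.mul_add, Matrix.mul_add]
    abel
  simp only [covLap, crossOp, quadOp, hterm, smul_add, Finset.sum_add_distrib, Matrix.transpose_sum,
    Matrix.transpose_smul, Matrix.transpose_mul, Matrix.transpose_transpose, Matrix.mul_assoc]

/-- **`Q_k(A) = Q_k(A₀) + F_2(A', A₀)`** ([B4] p. 580 «(F_{2,k}(A',A₀)φ)(y) = Σ_{x∈B^k(y)}
η^dF'_{1,k}(A'(Γ^{(k)}_{y,x}))U(A₀(Γ^{(k)}_{y,x}))φ(x), and F'_{1,k}(A) = U(A) − 1.»): `Q(T'T₀) = Q(T₀) + Q((T' − 1)T₀)`.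
[cite: Balaban1983RegularityDecay, p. 580] -/
theorem avgOp_kmul [Fintype ι] [DecidableEq ι] (q : Y → X → ℝ) (T' T₀ : Y → X → Matrix ι ι ℝ) :
    avgOp q (kmul T' T₀) = avgOp q T₀ + avgOp q (kmul (pertT T') T₀) := by
  unfold avgOp
  rw [← blockOp_add]
  congr 1
  funext y x
  simp only [Pi.add_apply, kmul_apply, pertT, sub_mul, one_mul, smul_sub]
  abel

/-- THE OPERATOR `F_{2,k}(A', A₀)` OF (2.24): `F_2 = Q_k((T' − 1)T₀)`. [cite: Balaban1983RegularityDecay, p. 580] -/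
def pertF [Fintype ι] [DecidableEq ι] (q : Y → X → ℝ) (T' T₀ : Y → X → Matrix ι ι ℝ) :
    Matrix (Y × ι) (X × ι) ℝ :=
  avgOp q (kmul (pertT T') T₀)

/-- **THE EXPANSION OF `P_k(A) = Q^*Q`**: `P(T'T₀) = P(T₀) + F_2^*Q_0 + Q_0^*F_2 + F_2^*F_2` (the `a`-terms of
(2.24)). [cite: Balaban1983RegularityDecay, p. 580 (2.24)] -/
theorem projOp_kmul [Fintype Y] [Fintype ι] [DecidableEq ι] (q : Y → X → ℝ) (T' T₀ : Y → X → Matrix ι ι ℝ) :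
    projOp q (kmul T' T₀)
      = projOp q T₀ + ((pertF q T' T₀)ᵀ * avgOp q T₀ + (avgOp q T₀)ᵀ * pertF q T' T₀
          + (pertF q T' T₀)ᵀ * pertF q T' T₀) := by
  unfold projOp pertF
  rw [avgOp_kmul, Matrix.transpose_add, Matrix.add_mul, Matrix.mul_add, Matrix.mul_add]
  abel

/-- THE PERTURBATION OPERATOR of (2.24): `vOp = C + Cᵀ + F_1^*F_1 + a(F_2^*Q_0 + Q_0^*F_2 + F_2^*F_2)`; the printed
`V` of (2.24)/(2.31) is `−vOp` (through `E = −ηF_1(−A')`, `c = η^{-2}`), so that `H(A) = H(A₀) − V = H(A₀) + vOp`.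
[cite: Balaban1983RegularityDecay, p. 580 (2.24), dictionary] -/
def vOp [Fintype X] [Fintype Y] [Fintype ι] [DecidableEq X] [DecidableEq ι] (c : X → X → ℝ) (a : ℝ)
    (q : Y → X → ℝ) (W' W₀ : X → X → Matrix ι ι ℝ) (T' T₀ : Y → X → Matrix ι ι ℝ) :
    Matrix (X × ι) (X × ι) ℝ :=
  crossOp c W₀ (pertE W') + (crossOp c W₀ (pertE W'))ᵀ + quadOp c (pertE W')
    + a • ((pertF q T' T₀)ᵀ * avgOp q T₀ + (avgOp q T₀)ᵀ * pertF q T' T₀ + (pertF q T' T₀)ᵀ * pertF q T' T₀)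

/-- **(2.24) AS AN OPERATOR IDENTITY**: `H(W'W₀, T'T₀) = H(W₀, T₀) + vOp` — [B4] (2.24), printed sandwiched
between `G_k^{1/2}(□,A₀)`: «= I − G_k^{1/2}(□,A₀)[F_{1,k}(−A')^*D^η_{A₀} + D^{η*}_{A₀}F_{1,k}(−A') −
F_{1,k}(−A')^*F_{1,k}(−A') − a_kF_{2,k}(A',A₀)^*Q_k(A₀) − a_kQ_k^*(A₀)F_{2,k}(A',A₀) −
a_kF_{2,k}(A',A₀)^*F_{2,k}(A',A₀)]G_k^{1/2}(□,A₀)» (our `vOp` is the UNSANDWICHED bracket with the printed signs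
reversed, `F_{1,k}(−A')` ↦ `E`, `F_{2,k}` ↦ `pertF`). [cite: Balaban1983RegularityDecay, pp. 579–580 (2.24)] -/
theorem covOp_kmul [Fintype X] [Fintype Y] [Fintype ι] [DecidableEq X] [DecidableEq ι] (c : X → X → ℝ)
    (m2 a : ℝ) (q : Y → X → ℝ) {W' : X → X → Matrix ι ι ℝ} (hW' : ∀ x y, (W' x y)ᵀ * W' x y = 1)
    (W₀ : X → X → Matrix ι ι ℝ) (T' T₀ : Y → X → Matrix ι ι ℝ) :
    covOp c m2 a q (kmul W' W₀) (kmul T' T₀) = covOp c m2 a q W₀ T₀ + vOp c a q W' W₀ T' T₀ := by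
  unfold covOp vOp
  rw [covLap_kmul c hW', projOp_kmul, smul_add]
  abel

/-- **(2.24) SANDWICHED, AS PRINTED**: for any `S` with `S·H(A₀)·S = 1` (e.g. `S = G_k(□,A₀)^{1/2}`),
`S·H(A)·S = 1 − S·V·S`, `V = −vOp`. [cite: Balaban1983RegularityDecay, p. 580 (2.24)] -/
theorem covOp_kmul_sandwich [Fintype X] [Fintype Y] [Fintype ι] [DecidableEq X] [DecidableEq ι]
    (c : X → X → ℝ) (m2 a : ℝ) (q : Y → X → ℝ) {W' : X → X → Matrix ι ι ℝ}
    (hW' : ∀ x y, (W' x y)ᵀ * W' x y = 1) (W₀ : X → X → Matrix ι ι ℝ) (T' T₀ : Y → X → Matrix ι ι ℝ)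
    {S : Matrix (X × ι) (X × ι) ℝ} (hS : S * covOp c m2 a q W₀ T₀ * S = 1) :
    S * covOp c m2 a q (kmul W' W₀) (kmul T' T₀) * S = 1 - S * (-vOp c a q W' W₀ T' T₀) * S := by
  rw [covOp_kmul c m2 a q hW', Matrix.mul_add, Matrix.add_mul, hS, Matrix.mul_neg, Matrix.neg_mul,
    sub_neg_eq_add]

/-! ### The abelian flow: `U(κ(A₀ + A')) = U(κA')U(κA₀)`, transporters multiply -/

/-- **`U(A₀ + A') = U(A')U(A₀)`** bondwise. [cite: Balaban1983RegularityDecay, p. 580] -/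
theorem fieldLink_add [Fintype ι] [DecidableEq ι] (F : OrthFlow ι) (κ : ℝ) (A₀ A' : X → X → ℝ) :
    fieldLink F κ (A₀ + A') = kmul (fieldLink F κ A') (fieldLink F κ A₀) := by
  funext u v
  simp only [fieldLink, kmul_apply, Pi.add_apply, mul_add]
  rw [F.map_add, F.comm]

/-- a matrix commuting with every link variable commutes with every transporter. [folklore] -/
theorem transport_comm [Fintype ι] [DecidableEq ι] {W : X → X → Matrix ι ι ℝ} {M : Matrix ι ι ℝ}
    (hM : ∀ u v, M * W u v = W u v * M) (x : X) (l : List X) : M * transport W x l = transport W x l * M := by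
  induction l generalizing x with
  | nil => simp [transport]
  | cons y l ih => rw [transport, ← Matrix.mul_assoc, hM, Matrix.mul_assoc, ih, Matrix.mul_assoc]

/-- **TRANSPORTERS OF COMMUTING LINK FIELDS MULTIPLY**: `U((A₀ + A')(Γ)) = U(A'(Γ))U(A₀(Γ))`. [folklore] -/
theorem transport_kmul [Fintype ι] [DecidableEq ι] {W' W₀ : X → X → Matrix ι ι ℝ}
    (hc : ∀ a b u v, W₀ a b * W' u v = W' u v * W₀ a b) (x : X) (l : List X) :
    transport (kmul W' W₀) x l = transport W' x l * transport W₀ x l := by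
  induction l generalizing x with
  | nil => simp [transport]
  | cons y l ih =>
      rw [transport, transport, transport, ih, kmul_apply]
      simp only [Matrix.mul_assoc]
      rw [← Matrix.mul_assoc (W₀ x y) (transport W' y l), transport_comm (fun u v => hc x y u v) y l,
        Matrix.mul_assoc]

/-- the contour transporters of commuting link fields multiply. [folklore] -/
theorem contourTrans_kmul [Fintype ι] [DecidableEq ι] {W' W₀ : X → X → Matrix ι ι ℝ}
    (hc : ∀ a b u v, W₀ a b * W' u v = W' u v * W₀ a b) (emb : Y → X) (Γ : Y → X → List X) :
    contourTrans (kmul W' W₀) emb Γ = kmul (contourTrans W' emb Γ) (contourTrans W₀ emb Γ) := by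
  funext y x
  exact transport_kmul hc _ _

/-- the link variables of the flow are orthogonal. [folklore] -/
theorem fieldLink_orth [Fintype ι] [DecidableEq ι] (F : OrthFlow ι) (κ : ℝ) (A : X → X → ℝ) (x y : X) :
    (fieldLink F κ A x y)ᵀ * fieldLink F κ A x y = 1 :=
  F.orth _

/-- **[B4]'s OPERATOR (1.6) EXPANDED ABOUT AN ARBITRARY BACKGROUND**: `H(A₀ + A') = H(A₀) + vOp` with the
perturbation factors `U(κA'_b)` and `U(κA'(Γ_{y,x}))` — (2.24) for the operator of (1.6) itself.
[cite: Balaban1983RegularityDecay, p. 580 (2.24)] -/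
theorem b4Op_add [Fintype X] [Fintype Y] [Fintype ι] [DecidableEq X] [DecidableEq ι] (F : OrthFlow ι) (κ : ℝ)
    (c : X → X → ℝ) (m2 a : ℝ) (q : Y → X → ℝ) (emb : Y → X) (Γ : Y → X → List X) (A₀ A' : X → X → ℝ) :
    b4Op F κ c m2 a q emb Γ (A₀ + A')
      = b4Op F κ c m2 a q emb Γ A₀
        + vOp c a q (fieldLink F κ A') (fieldLink F κ A₀) (contourTrans (fieldLink F κ A') emb Γ)
            (contourTrans (fieldLink F κ A₀) emb Γ) := by
  have hc : ∀ a b u v, fieldLink F κ A₀ a b * fieldLink F κ A' u v = fieldLink F κ A' u v * fieldLink F κ A₀ a b :=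
    fun a b u v => F.comm _ _
  rw [b4Op, b4Op, fieldLink_add, contourTrans_kmul hc, covOp_kmul c m2 a q (fieldLink_orth F κ A')]

/-! ## §3 The resolvent identities behind (2.26) and (2.31) -/

/-- **THE SECOND RESOLVENT IDENTITY**: `G = G₀ + G₀VG` for `H = H₀ − V`, `G = H^{-1}`, `G₀ = H₀^{-1}`.
[folklore] -/
theorem inv_sub_eq {n : Type*} [Fintype n] [DecidableEq n] {H₀ V : Matrix n n ℝ} (h₀ : IsUnit H₀.det)
    (h : IsUnit (H₀ - V).det) : (H₀ - V)⁻¹ = H₀⁻¹ + H₀⁻¹ * V * (H₀ - V)⁻¹ := by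
  have e1 : H₀⁻¹ * (H₀ - V) = 1 - H₀⁻¹ * V := by rw [Matrix.mul_sub, Matrix.nonsing_inv_mul _ h₀]
  have e2 : (1 - H₀⁻¹ * V) * (H₀ - V)⁻¹ = H₀⁻¹ := by
    rw [← e1, Matrix.mul_assoc, Matrix.mul_nonsing_inv _ h, Matrix.mul_one]
  rw [Matrix.sub_mul, Matrix.one_mul, sub_eq_iff_eq_add] at e2
  exact e2

/-- **THE EXPANSION (2.31) TO ORDER `N` WITH REMAINDER**: `G = Σ_{k<N} (G₀V)^kG₀ + (G₀V)^N G`.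
[cite: Balaban1983RegularityDecay, p. 581 (2.31)] -/
theorem inv_sub_expand {n : Type*} [Fintype n] [DecidableEq n] {H₀ V : Matrix n n ℝ} (h₀ : IsUnit H₀.det)
    (h : IsUnit (H₀ - V).det) (N : ℕ) :
    (H₀ - V)⁻¹ = ∑ k ∈ Finset.range N, (H₀⁻¹ * V) ^ k * H₀⁻¹ + (H₀⁻¹ * V) ^ N * (H₀ - V)⁻¹ := by
  induction N with
  | zero => simp
  | succ N ih =>
      rw [Finset.sum_range_succ, pow_succ, add_assoc, Matrix.mul_assoc ((H₀⁻¹ * V) ^ N) (H₀⁻¹ * V) (H₀ - V)⁻¹,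
        ← Matrix.mul_add ((H₀⁻¹ * V) ^ N), ← inv_sub_eq h₀ h]
      exact ih

/-- `(G₀V)^kG₀ = G₀(VG₀)^k` — the two printed orderings of the Neumann terms. [folklore] -/
theorem pow_mul_shift {n : Type*} [Fintype n] [DecidableEq n] (G₀ V : Matrix n n ℝ) (k : ℕ) :
    (G₀ * V) ^ k * G₀ = G₀ * (V * G₀) ^ k := by
  induction k with
  | zero => simp
  | succ k ih => rw [pow_succ, pow_succ, Matrix.mul_assoc ((G₀ * V) ^ k) (G₀ * V) G₀, Matrix.mul_assoc G₀ V G₀,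
      ← Matrix.mul_assoc ((G₀ * V) ^ k) G₀ (V * G₀), ih, Matrix.mul_assoc]

/-- **(2.26)**: if `S·H₀·S = 1` with `S` invertible (e.g. `S = G₀^{1/2}`) and `1 − SVS` is invertible, then
`(H₀ − V)^{-1} = S(1 − SVS)^{-1}S`. [cite: Balaban1983RegularityDecay, p. 580 (2.26)] -/
theorem inv_sub_eq_sandwich {n : Type*} [Fintype n] [DecidableEq n] {H₀ V S : Matrix n n ℝ}
    (hS : S * H₀ * S = 1) (hSu : IsUnit S.det) (hK : IsUnit (1 - S * V * S).det) :
    (H₀ - V)⁻¹ = S * (1 - S * V * S)⁻¹ * S := by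
  have hK' : S * (H₀ - V) * S = 1 - S * V * S := by rw [Matrix.mul_sub, Matrix.sub_mul, hS]
  have hH : H₀ - V = S⁻¹ * (1 - S * V * S) * S⁻¹ := by
    rw [← hK', ← Matrix.mul_assoc, ← Matrix.mul_assoc, Matrix.nonsing_inv_mul _ hSu, Matrix.one_mul,
      Matrix.mul_assoc, Matrix.mul_nonsing_inv _ hSu, Matrix.mul_one]
  apply Matrix.inv_eq_right_inv
  rw [hH]
  set K := 1 - S * V * S
  calc S⁻¹ * K * S⁻¹ * (S * K⁻¹ * S) = S⁻¹ * K * (S⁻¹ * S) * K⁻¹ * S := by simp only [Matrix.mul_assoc]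
    _ = 1 := by rw [Matrix.nonsing_inv_mul _ hSu, Matrix.mul_one, Matrix.mul_assoc S⁻¹, Matrix.mul_nonsing_inv _ hK,
      Matrix.mul_one, Matrix.nonsing_inv_mul _ hSu]

end Expansion

section Forms

variable {X Y ι : Type*}

/-! ## §4 Quadratic forms: the positivity (1.8) of `H(A₀)` survives a small perturbation of the link variables

[B4] runs the expansion (2.24) with OPERATOR norms of `G^{1/2}VG^{1/2}` ((2.25)); we run it at the level of
QUADRATIC FORMS, where the two cross terms are absorbed by the elementary inequality
`|u + v|² ≥ (1 − t)|u|² + (1 − t^{-1})|v|²` — no square roots and no Neumann series are needed for positivity. -/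

/-- `0 ≤ |v|²`. [folklore] -/
theorem dotProduct_self_nonneg' [Fintype ι] (v : ι → ℝ) : 0 ≤ v ⬝ᵥ v :=
  Finset.sum_nonneg fun _ _ => mul_self_nonneg _

/-- **THE ABSORPTION INEQUALITY** `|u + v|² ≥ (1 − t)|u|² + (1 − t^{-1})|v|²` for `t > 0`
(`= t^{-1}|tu + v|² ≥ 0`). [folklore] -/
theorem add_dotProduct_add_ge [Fintype ι] (u v : ι → ℝ) {t : ℝ} (ht : 0 < t) :
    (1 - t) * (u ⬝ᵥ u) + (1 - t⁻¹) * (v ⬝ᵥ v) ≤ (u + v) ⬝ᵥ (u + v) := by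
  have h0 := dotProduct_self_nonneg' (t • u + v)
  have key : (u + v) ⬝ᵥ (u + v) - ((1 - t) * (u ⬝ᵥ u) + (1 - t⁻¹) * (v ⬝ᵥ v))
      = t⁻¹ * ((t • u + v) ⬝ᵥ (t • u + v)) := by
    simp only [add_dotProduct, dotProduct_add, smul_dotProduct, dotProduct_smul, smul_eq_mul, dotProduct_comm v u]
    field_simp
    ring
  have : 0 ≤ t⁻¹ * ((t • u + v) ⬝ᵥ (t • u + v)) := mul_nonneg (inv_nonneg.2 ht.le) h0
  linarith

/-- orthogonal matrices preserve `|·|²`. [folklore] -/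
theorem orth_dotProduct_mulVec_self [Fintype ι] [DecidableEq ι] {O : Matrix ι ι ℝ} (hO : Oᵀ * O = 1)
    (u : ι → ℝ) : (O *ᵥ u) ⬝ᵥ (O *ᵥ u) = u ⬝ᵥ u :=
  IsGauge.dotProduct_mulVec_self (g := fun _ : Unit => O) (fun _ => hO) () u

/-- `⟨Φ, Ψ⟩ = Σ_x ⟨φ(x), ψ(x)⟩`. [folklore] -/
theorem dotProduct_eq_sum_fld [Fintype X] [Fintype ι] (Φ Ψ : X × ι → ℝ) :
    Φ ⬝ᵥ Ψ = ∑ x, fld Φ x ⬝ᵥ fld Ψ x := by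
  simp only [dotProduct, Fintype.sum_prod_type, fld_apply]

/-- **THE QUADRATIC FORM OF `−Δ_{A₀+A'}`**: `⟨Φ, −Δ_{W'W₀}Φ⟩ = Σ c(x,y)|(W₀(x,y)φ(y) − φ(x)) + E(x,y)φ(x)|²`
(the orthogonal factor `W'(x,y)` in front drops out of the norm). [folklore] -/
theorem covLap_form_kmul [Fintype X] [Fintype ι] [DecidableEq X] [DecidableEq ι] (c : X → X → ℝ)
    {W' : X → X → Matrix ι ι ℝ} (hW' : ∀ x y, (W' x y)ᵀ * W' x y = 1) (W₀ : X → X → Matrix ι ι ℝ)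
    (Φ : X × ι → ℝ) :
    Φ ⬝ᵥ (covLap c (kmul W' W₀) *ᵥ Φ)
      = ∑ x, ∑ y, c x y * (((W₀ x y *ᵥ fld Φ y - fld Φ x) + pertE W' x y *ᵥ fld Φ x)
          ⬝ᵥ ((W₀ x y *ᵥ fld Φ y - fld Φ x) + pertE W' x y *ᵥ fld Φ x)) := by
  rw [covLap_form]
  refine Finset.sum_congr rfl fun x _ => Finset.sum_congr rfl fun y _ => ?_
  have h1 : W' x y * (1 - (W' x y)ᵀ) = W' x y - 1 := by
    rw [Matrix.mul_sub, Matrix.mul_one, mul_eq_one_comm.1 (hW' x y)]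
  have h : kmul W' W₀ x y *ᵥ fld Φ y - fld Φ x
      = W' x y *ᵥ ((W₀ x y *ᵥ fld Φ y - fld Φ x) + pertE W' x y *ᵥ fld Φ x) := by
    rw [kmul_apply, pertE, Matrix.mulVec_add, Matrix.mulVec_mulVec, h1, Matrix.mulVec_sub, Matrix.mulVec_mulVec,
      Matrix.sub_mulVec, Matrix.one_mulVec]
    abel
  rw [h, orth_dotProduct_mulVec_self (hW' x y)]

/-- **LOWER COMPARISON FOR `−Δ`**: `⟨Φ, −Δ_{W'W₀}Φ⟩ ≥ (1 − t)⟨Φ, −Δ_{W₀}Φ⟩ + (1 − t^{-1})Σ c|E(x,y)φ(x)|²`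
(`t > 0`, non-negative bond weights). [folklore] -/
theorem covLap_kmul_form_ge [Fintype X] [Fintype ι] [DecidableEq X] [DecidableEq ι] {c : X → X → ℝ}
    (hc : ∀ x y, 0 ≤ c x y) {W' : X → X → Matrix ι ι ℝ} (hW' : ∀ x y, (W' x y)ᵀ * W' x y = 1)
    (W₀ : X → X → Matrix ι ι ℝ) {t : ℝ} (ht : 0 < t) (Φ : X × ι → ℝ) :
    (1 - t) * (Φ ⬝ᵥ (covLap c W₀ *ᵥ Φ))
        + (1 - t⁻¹) * ∑ x, ∑ y, c x y * ((pertE W' x y *ᵥ fld Φ x) ⬝ᵥ (pertE W' x y *ᵥ fld Φ x))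
      ≤ Φ ⬝ᵥ (covLap c (kmul W' W₀) *ᵥ Φ) := by
  rw [covLap_form_kmul c hW', covLap_form, Finset.mul_sum, Finset.mul_sum, ← Finset.sum_add_distrib]
  refine Finset.sum_le_sum fun x _ => ?_
  rw [Finset.mul_sum, Finset.mul_sum, ← Finset.sum_add_distrib]
  refine Finset.sum_le_sum fun y _ => ?_
  have h := add_dotProduct_add_ge (W₀ x y *ᵥ fld Φ y - fld Φ x) (pertE W' x y *ᵥ fld Φ x) ht
  have h' := mul_le_mul_of_nonneg_left h (hc x y)
  linarith

/-- **LOWER COMPARISON FOR `P_k`**: `⟨Φ, P(T'T₀)Φ⟩ ≥ (1 − t)⟨Φ, P(T₀)Φ⟩ + (1 − t^{-1})|F_2Φ|²`. [folklore] -/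
theorem projOp_kmul_form_ge [Fintype X] [Fintype Y] [Fintype ι] [DecidableEq ι] (q : Y → X → ℝ)
    (T' T₀ : Y → X → Matrix ι ι ℝ) {t : ℝ} (ht : 0 < t) (Φ : X × ι → ℝ) :
    (1 - t) * (Φ ⬝ᵥ (projOp q T₀ *ᵥ Φ)) + (1 - t⁻¹) * ((pertF q T' T₀ *ᵥ Φ) ⬝ᵥ (pertF q T' T₀ *ᵥ Φ))
      ≤ Φ ⬝ᵥ (projOp q (kmul T' T₀) *ᵥ Φ) := by
  rw [projOp_form, projOp_form, avgOp_kmul, Matrix.add_mulVec]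
  exact add_dotProduct_add_ge _ _ ht

/-- the quadratic form of `H = −Δ + m² + aP`. [folklore] -/
theorem covOp_form [Fintype X] [Fintype Y] [Fintype ι] [DecidableEq X] [DecidableEq ι] (c : X → X → ℝ)
    (m2 a : ℝ) (q : Y → X → ℝ) (W : X → X → Matrix ι ι ℝ) (T : Y → X → Matrix ι ι ℝ) (Φ : X × ι → ℝ) :
    Φ ⬝ᵥ (covOp c m2 a q W T *ᵥ Φ)
      = Φ ⬝ᵥ (covLap c W *ᵥ Φ) + m2 * (Φ ⬝ᵥ Φ) + a * (Φ ⬝ᵥ (projOp q T *ᵥ Φ)) := by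
  simp only [covOp, Matrix.add_mulVec, Matrix.smul_mulVec, Matrix.one_mulVec, dotProduct_add,
    dotProduct_smul, smul_eq_mul]

/-- **ABSTRACT POSITIVITY TRANSFER** (the quadratic-form version of [B4]'s step (2.24)–(2.26), p. 580 «we can easily
prove that ‖G_k^{1/2}(□,A₀)V_kG_k^{1/2}(□,A₀)‖_{2,2} ≤ O(1)e^β»): if the
massless background operator is bounded below by `γ₀` and the perturbation factors are small in the sense
`Σ_y c|E(x,y)v|² ≤ ε₁|v|²`-summed and `|F_2Φ|² ≤ ε₂|Φ|²`, then
`⟨Φ, H(W'W₀, T'T₀)Φ⟩ ≥ ((1 − t)γ₀ + m² − (t^{-1} − 1)(ε₁ + aε₂))|Φ|²` for every `0 < t ≤ 1`. [folklore] -/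
theorem covOp_kmul_form_ge [Fintype X] [Fintype Y] [Fintype ι] [DecidableEq X] [DecidableEq ι]
    {c : X → X → ℝ} (hc : ∀ x y, 0 ≤ c x y) (m2 : ℝ) {a : ℝ} (ha : 0 ≤ a) (q : Y → X → ℝ)
    {W' : X → X → Matrix ι ι ℝ} (hW' : ∀ x y, (W' x y)ᵀ * W' x y = 1) (W₀ : X → X → Matrix ι ι ℝ)
    (T' T₀ : Y → X → Matrix ι ι ℝ) {γ₀ ε₁ ε₂ t : ℝ} (ht : 0 < t) (ht1 : t ≤ 1)
    (h0 : ∀ Φ : X × ι → ℝ, γ₀ * (Φ ⬝ᵥ Φ) ≤ Φ ⬝ᵥ (covLap c W₀ *ᵥ Φ) + a * (Φ ⬝ᵥ (projOp q T₀ *ᵥ Φ)))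
    (hE : ∀ Φ : X × ι → ℝ,
      ∑ x, ∑ y, c x y * ((pertE W' x y *ᵥ fld Φ x) ⬝ᵥ (pertE W' x y *ᵥ fld Φ x)) ≤ ε₁ * (Φ ⬝ᵥ Φ))
    (hF : ∀ Φ : X × ι → ℝ, (pertF q T' T₀ *ᵥ Φ) ⬝ᵥ (pertF q T' T₀ *ᵥ Φ) ≤ ε₂ * (Φ ⬝ᵥ Φ))
    (Φ : X × ι → ℝ) :
    ((1 - t) * γ₀ + m2 - (t⁻¹ - 1) * (ε₁ + a * ε₂)) * (Φ ⬝ᵥ Φ)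
      ≤ Φ ⬝ᵥ (covOp c m2 a q (kmul W' W₀) (kmul T' T₀) *ᵥ Φ) := by
  rw [covOp_form]
  have h1 := covLap_kmul_form_ge hc hW' W₀ ht Φ
  have h2 := mul_le_mul_of_nonneg_left (projOp_kmul_form_ge q T' T₀ ht Φ) ha
  have ht' : 0 ≤ t⁻¹ - 1 := sub_nonneg.2 ((one_le_inv₀ ht).2 ht1)
  have h3 := mul_le_mul_of_nonneg_left (h0 Φ) (sub_nonneg.2 ht1)
  have h4 := mul_le_mul_of_nonneg_left (hE Φ) ht'
  have h5 := mul_le_mul_of_nonneg_left (hF Φ) (mul_nonneg ha ht')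
  linarith

/-- **… WITH `t = 1/2`**: `ε₁ + aε₂ ≤ γ₀/4 ⇒ ⟨Φ, H(A)Φ⟩ ≥ (γ₀/4 + m²)|Φ|²`. [folklore] -/
theorem covOp_kmul_form_ge_quarter [Fintype X] [Fintype Y] [Fintype ι] [DecidableEq X] [DecidableEq ι]
    {c : X → X → ℝ} (hc : ∀ x y, 0 ≤ c x y) (m2 : ℝ) {a : ℝ} (ha : 0 ≤ a) (q : Y → X → ℝ)
    {W' : X → X → Matrix ι ι ℝ} (hW' : ∀ x y, (W' x y)ᵀ * W' x y = 1) (W₀ : X → X → Matrix ι ι ℝ)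
    (T' T₀ : Y → X → Matrix ι ι ℝ) {γ₀ ε₁ ε₂ : ℝ}
    (h0 : ∀ Φ : X × ι → ℝ, γ₀ * (Φ ⬝ᵥ Φ) ≤ Φ ⬝ᵥ (covLap c W₀ *ᵥ Φ) + a * (Φ ⬝ᵥ (projOp q T₀ *ᵥ Φ)))
    (hE : ∀ Φ : X × ι → ℝ,
      ∑ x, ∑ y, c x y * ((pertE W' x y *ᵥ fld Φ x) ⬝ᵥ (pertE W' x y *ᵥ fld Φ x)) ≤ ε₁ * (Φ ⬝ᵥ Φ))
    (hF : ∀ Φ : X × ι → ℝ, (pertF q T' T₀ *ᵥ Φ) ⬝ᵥ (pertF q T' T₀ *ᵥ Φ) ≤ ε₂ * (Φ ⬝ᵥ Φ))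
    (hsmall : ε₁ + a * ε₂ ≤ γ₀ / 4) (Φ : X × ι → ℝ) :
    (γ₀ / 4 + m2) * (Φ ⬝ᵥ Φ) ≤ Φ ⬝ᵥ (covOp c m2 a q (kmul W' W₀) (kmul T' T₀) *ᵥ Φ) := by
  have h := covOp_kmul_form_ge hc m2 ha q hW' W₀ T' T₀ (t := 1 / 2) (by norm_num) (by norm_num) h0 hE hF Φ
  have hn := dotProduct_self_nonneg' Φ
  have h' := mul_le_mul_of_nonneg_right hsmall hn
  norm_num at h
  linarith

/-- a SITEWISE bound `Σ_y c(x,y)|E(x,y)v|² ≤ ε₁|v|²` sums to the field bound. [folklore] -/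
theorem pertE_form_le [Fintype X] [Fintype ι] {c : X → X → ℝ} {E : X → X → Matrix ι ι ℝ} {ε₁ : ℝ}
    (h : ∀ x (v : ι → ℝ), ∑ y, c x y * ((E x y *ᵥ v) ⬝ᵥ (E x y *ᵥ v)) ≤ ε₁ * (v ⬝ᵥ v)) (Φ : X × ι → ℝ) :
    ∑ x, ∑ y, c x y * ((E x y *ᵥ fld Φ x) ⬝ᵥ (E x y *ᵥ fld Φ x)) ≤ ε₁ * (Φ ⬝ᵥ Φ) := by
  rw [dotProduct_eq_sum_fld Φ Φ, Finset.mul_sum]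
  exact Finset.sum_le_sum fun x _ => h x (fld Φ x)

/-- **WEIGHTED CAUCHY–SCHWARZ** for vector sums: `|Σ_x q_x w_x|² ≤ (Σ_x q_x)·Σ_x q_x|w_x|²` (`q ≥ 0`). [folklore] -/
theorem sum_smul_dotProduct_self_le [Fintype ι] (s : Finset X) {q : X → ℝ} (hq : ∀ x, 0 ≤ q x)
    (w : X → ι → ℝ) :
    (∑ x ∈ s, q x • w x) ⬝ᵥ (∑ x ∈ s, q x • w x) ≤ (∑ x ∈ s, q x) * ∑ x ∈ s, q x * (w x ⬝ᵥ w x) := by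
  have hi : ∀ i, (∑ x ∈ s, q x * w x i) ^ 2 ≤ (∑ x ∈ s, q x) * ∑ x ∈ s, q x * (w x i) ^ 2 := by
    intro i
    have := Finset.sum_mul_sq_le_sq_mul_sq s (fun x => Real.sqrt (q x)) (fun x => Real.sqrt (q x) * w x i)
    have e1 : ∀ x, Real.sqrt (q x) * (Real.sqrt (q x) * w x i) = q x * w x i := fun x => by
      rw [← mul_assoc, Real.mul_self_sqrt (hq x)]
    have e2 : ∀ x, Real.sqrt (q x) ^ 2 = q x := fun x => Real.sq_sqrt (hq x)
    have e3 : ∀ x, (Real.sqrt (q x) * w x i) ^ 2 = q x * (w x i) ^ 2 := fun x => by rw [mul_pow, e2]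
    simp only [e1, e2, e3] at this
    exact this
  calc (∑ x ∈ s, q x • w x) ⬝ᵥ (∑ x ∈ s, q x • w x) = ∑ i, (∑ x ∈ s, q x * w x i) ^ 2 := by
        simp only [dotProduct, Finset.sum_apply, Pi.smul_apply, smul_eq_mul, sq]
    _ ≤ ∑ i, (∑ x ∈ s, q x) * ∑ x ∈ s, q x * (w x i) ^ 2 := Finset.sum_le_sum fun i _ => hi i
    _ = (∑ x ∈ s, q x) * ∑ x ∈ s, q x * (w x ⬝ᵥ w x) := by
        rw [← Finset.mul_sum, Finset.sum_comm]
        simp only [dotProduct, Finset.mul_sum, sq]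

/-- **THE BOUND ON `F_2`**: if `q ≥ 0` has row sums `≤ ρ₁` and column sums `≤ ρ₂`, the background transporters
are orthogonal and `|(T'(y,x) − 1)v|² ≤ ε|v|²` wherever `q(y,x) ≠ 0`, then `|F_2Φ|² ≤ ρ₁ρ₂ε|Φ|²` (the size of [B4]'s
`F_{2,k}(A',A₀)`, p. 580, by Cauchy–Schwarz over the block). [folklore] -/
theorem pertF_form_le [Fintype X] [Fintype Y] [Fintype ι] [DecidableEq ι] {q : Y → X → ℝ}
    (hq : ∀ y x, 0 ≤ q y x) {ρ₁ ρ₂ ε : ℝ} (hρ₁ : 0 ≤ ρ₁) (hε : 0 ≤ ε) (hrow : ∀ y, ∑ x, q y x ≤ ρ₁)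
    (hcol : ∀ x, ∑ y, q y x ≤ ρ₂) {T' T₀ : Y → X → Matrix ι ι ℝ} (hT₀ : ∀ y x, (T₀ y x)ᵀ * T₀ y x = 1)
    (hT' : ∀ y x (v : ι → ℝ), q y x ≠ 0 → ((T' y x - 1) *ᵥ v) ⬝ᵥ ((T' y x - 1) *ᵥ v) ≤ ε * (v ⬝ᵥ v))
    (Φ : X × ι → ℝ) :
    (pertF q T' T₀ *ᵥ Φ) ⬝ᵥ (pertF q T' T₀ *ᵥ Φ) ≤ ρ₁ * ρ₂ * ε * (Φ ⬝ᵥ Φ) := by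
  have hn : ∀ x, 0 ≤ ε * (fld Φ x ⬝ᵥ fld Φ x) := fun x => mul_nonneg hε (dotProduct_self_nonneg' _)
  have hy : ∀ y, fld (pertF q T' T₀ *ᵥ Φ) y ⬝ᵥ fld (pertF q T' T₀ *ᵥ Φ) y
      ≤ ρ₁ * ∑ x, q y x * (ε * (fld Φ x ⬝ᵥ fld Φ x)) := by
    intro y
    rw [pertF, fld_avgOp_mulVec]
    refine (sum_smul_dotProduct_self_le Finset.univ (hq y) _).trans ?_
    have hterm : ∀ x, q y x * ((kmul (pertT T') T₀ y x *ᵥ fld Φ x) ⬝ᵥ (kmul (pertT T') T₀ y x *ᵥ fld Φ x))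
        ≤ q y x * (ε * (fld Φ x ⬝ᵥ fld Φ x)) := by
      intro x
      by_cases hqx : q y x = 0
      · rw [hqx, zero_mul, zero_mul]
      · refine mul_le_mul_of_nonneg_left ?_ (hq y x)
        rw [kmul_apply, pertT, ← Matrix.mulVec_mulVec]
        calc _ ≤ ε * ((T₀ y x *ᵥ fld Φ x) ⬝ᵥ (T₀ y x *ᵥ fld Φ x)) := hT' y x _ hqx
          _ = ε * (fld Φ x ⬝ᵥ fld Φ x) := by rw [orth_dotProduct_mulVec_self (hT₀ y x)]
    have hS : 0 ≤ ∑ x, q y x * (ε * (fld Φ x ⬝ᵥ fld Φ x)) :=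
      Finset.sum_nonneg fun x _ => mul_nonneg (hq y x) (hn x)
    calc _ ≤ (∑ x, q y x) * ∑ x, q y x * (ε * (fld Φ x ⬝ᵥ fld Φ x)) :=
          mul_le_mul_of_nonneg_left (Finset.sum_le_sum fun x _ => hterm x) (Finset.sum_nonneg fun x _ => hq y x)
      _ ≤ ρ₁ * ∑ x, q y x * (ε * (fld Φ x ⬝ᵥ fld Φ x)) := mul_le_mul_of_nonneg_right (hrow y) hS
  rw [dotProduct_eq_sum_fld (pertF q T' T₀ *ᵥ Φ) (pertF q T' T₀ *ᵥ Φ)]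
  calc ∑ y, fld (pertF q T' T₀ *ᵥ Φ) y ⬝ᵥ fld (pertF q T' T₀ *ᵥ Φ) y
        ≤ ∑ y, ρ₁ * ∑ x, q y x * (ε * (fld Φ x ⬝ᵥ fld Φ x)) := Finset.sum_le_sum fun y _ => hy y
    _ = ρ₁ * ∑ x, (∑ y, q y x) * (ε * (fld Φ x ⬝ᵥ fld Φ x)) := by
        rw [← Finset.mul_sum, Finset.sum_comm]
        simp only [Finset.sum_mul]
    _ ≤ ρ₁ * ∑ x, ρ₂ * (ε * (fld Φ x ⬝ᵥ fld Φ x)) :=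
        mul_le_mul_of_nonneg_left (Finset.sum_le_sum fun x _ => mul_le_mul_of_nonneg_right (hcol x) (hn x)) hρ₁
    _ = ρ₁ * ρ₂ * ε * (Φ ⬝ᵥ Φ) := by
        rw [dotProduct_eq_sum_fld Φ Φ, Finset.mul_sum, Finset.mul_sum]
        refine Finset.sum_congr rfl fun x _ => ?_
        ring

/-! ### Positivity ⇒ invertibility and `L²` bounds on the Green's function -/

/-- a matrix with `⟨v, Hv⟩ ≥ γ|v|²`, `γ > 0`, is invertible. [folklore] -/
theorem isUnit_det_of_form_ge {n : Type*} [Fintype n] [DecidableEq n] {H : Matrix n n ℝ} {γ : ℝ} (hγ : 0 < γ)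
    (h : ∀ v, γ * (v ⬝ᵥ v) ≤ v ⬝ᵥ (H *ᵥ v)) : IsUnit H.det := by
  rw [← Matrix.isUnit_iff_isUnit_det, ← Matrix.mulVec_injective_iff_isUnit]
  intro v w hvw
  have h1 : H *ᵥ (v - w) = 0 := by rw [Matrix.mulVec_sub, hvw, sub_self]
  have h2 := h (v - w)
  rw [h1, dotProduct_zero] at h2
  have h3 : (v - w) ⬝ᵥ (v - w) ≤ 0 := by
    by_contra hlt
    have := mul_pos hγ (not_le.1 hlt)
    linarith
  have h4 : (v - w) ⬝ᵥ (v - w) = 0 := le_antisymm h3 (dotProduct_self_nonneg' _)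
  exact sub_eq_zero.1 (dotProduct_self_eq_zero.1 h4)

/-- **`L²` BOUND ON THE GREEN'S FUNCTION FROM POSITIVITY**: `⟨v,Hv⟩ ≥ γ|v|²` (`γ > 0`) gives
`γ²|H⁻¹f|² ≤ |f|²`. [folklore] -/
theorem inv_mulVec_sq_le {n : Type*} [Fintype n] [DecidableEq n] {H : Matrix n n ℝ} {γ : ℝ} (hγ : 0 < γ)
    (h : ∀ v, γ * (v ⬝ᵥ v) ≤ v ⬝ᵥ (H *ᵥ v)) (f : n → ℝ) :
    γ ^ 2 * ((H⁻¹ *ᵥ f) ⬝ᵥ (H⁻¹ *ᵥ f)) ≤ f ⬝ᵥ f := by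
  set v := H⁻¹ *ᵥ f with hv
  have hH : H *ᵥ v = f := by rw [hv, Matrix.mulVec_mulVec, Matrix.mul_nonsing_inv _ (isUnit_det_of_form_ge hγ h),
    Matrix.one_mulVec]
  have h1 : γ * (v ⬝ᵥ v) ≤ v ⬝ᵥ f := by simpa [hH] using h v
  have hcs : (v ⬝ᵥ f) ^ 2 ≤ (v ⬝ᵥ v) * (f ⬝ᵥ f) := by
    have := Finset.sum_mul_sq_le_sq_mul_sq Finset.univ v f
    simpa [dotProduct, sq] using this
  have hvv := dotProduct_self_nonneg' v
  have h2 : (γ * (v ⬝ᵥ v)) ^ 2 ≤ (v ⬝ᵥ f) ^ 2 := pow_le_pow_left₀ (mul_nonneg hγ.le hvv) h1 2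
  rcases hvv.eq_or_lt with h0 | hpos
  · rw [← h0, mul_zero]; exact dotProduct_self_nonneg' f
  · have h3 : γ ^ 2 * (v ⬝ᵥ v) * (v ⬝ᵥ v) ≤ (f ⬝ᵥ f) * (v ⬝ᵥ v) := by nlinarith
    exact le_of_mul_le_mul_right h3 hpos

/-- **ENERGY BOUND**: `⟨H⁻¹f, f⟩ ≤ γ^{-1}|f|²` (so also `Σ c|D_{A}H⁻¹f|² ≤ γ^{-1}|f|²` whenever the remaining terms
of the form are non-negative). [folklore] -/
theorem inv_mulVec_dotProduct_le {n : Type*} [Fintype n] [DecidableEq n] {H : Matrix n n ℝ} {γ : ℝ} (hγ : 0 < γ)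
    (h : ∀ v, γ * (v ⬝ᵥ v) ≤ v ⬝ᵥ (H *ᵥ v)) (f : n → ℝ) :
    (H⁻¹ *ᵥ f) ⬝ᵥ f ≤ γ⁻¹ * (f ⬝ᵥ f) := by
  set v := H⁻¹ *ᵥ f with hv
  have hH : H *ᵥ v = f := by rw [hv, Matrix.mulVec_mulVec, Matrix.mul_nonsing_inv _ (isUnit_det_of_form_ge hγ h),
    Matrix.one_mulVec]
  have h1 : γ * (v ⬝ᵥ v) ≤ v ⬝ᵥ f := by simpa [hH] using h v
  have hcs : (v ⬝ᵥ f) ^ 2 ≤ (v ⬝ᵥ v) * (f ⬝ᵥ f) := by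
    have := Finset.sum_mul_sq_le_sq_mul_sq Finset.univ v f
    simpa [dotProduct, sq] using this
  have hvv := dotProduct_self_nonneg' v
  have hff := dotProduct_self_nonneg' f
  have hvf : 0 ≤ v ⬝ᵥ f := le_trans (mul_nonneg hγ.le hvv) h1
  rcases hvf.eq_or_lt with h0 | hpos
  · rw [← h0]; exact mul_nonneg (inv_nonneg.2 hγ.le) hff
  · have k2 : γ * (v ⬝ᵥ f) ≤ f ⬝ᵥ f := by
      have : γ * (v ⬝ᵥ f) * (v ⬝ᵥ f) ≤ (f ⬝ᵥ f) * (v ⬝ᵥ f) := by nlinarith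
      exact le_of_mul_le_mul_right this hpos
    calc v ⬝ᵥ f = γ⁻¹ * (γ * (v ⬝ᵥ f)) := by field_simp
      _ ≤ γ⁻¹ * (f ⬝ᵥ f) := mul_le_mul_of_nonneg_left k2 (inv_nonneg.2 hγ.le)

end Forms

section Paths

variable {X ι : Type*}

/-! ## §5 Abelian transporters: `U(A(Γ)) = U(κ Σ_{b⊂Γ} A_b)` and the bound `|A'(Γ)| ≤ |Γ|·sup|A'_b|` -/

/-- consecutive sites of a contour are related by `r` (for [B4]'s contours: nearest neighbours). [folklore] -/
def PathRel (r : X → X → Prop) : X → List X → Prop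
  | _, [] => True
  | x, y :: l => r x y ∧ PathRel r y l

/-- `A(Γ) = Σ_{b ⊂ Γ} A_b` along the contour `x → l₀ → l₁ → ⋯`. [cite: Balaban1983RegularityDecay, p. 572 «A(Γ) = Σ_{b⊂Γ} A_b»] -/
def lsum (B : X → X → ℝ) : X → List X → ℝ
  | _, [] => 0
  | x, y :: l => B x y + lsum B y l

/-- **`U(A(Γ)) = exp(qeη Σ_{b⊂Γ} A_b)`**: the transporter of the abelian flow along a contour is the flow at the
summed field. [cite: Balaban1983RegularityDecay, p. 572 (1.4)] -/
theorem transport_fieldLink [Fintype ι] [DecidableEq ι] (F : OrthFlow ι) (κ : ℝ) (B : X → X → ℝ) (x : X)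
    (l : List X) : transport (fieldLink F κ B) x l = F.U (κ * lsum B x l) := by
  induction l generalizing x with
  | nil => simp [transport, lsum, F.map_zero]
  | cons y l ih => rw [transport, ih, lsum, mul_add, F.map_add]; rfl

/-- `|κA'(Γ)| ≤ |Γ|·r` when every step of `Γ` is an `r`-bond with `|κA'_b| ≤ r`. [folklore] -/
theorem abs_lsum_le {r : X → X → Prop} {κ : ℝ} {B : X → X → ℝ} {ρ : ℝ}
    (hB : ∀ u v, r u v → |κ * B u v| ≤ ρ) : ∀ (x : X) (l : List X), PathRel r x l →
      |κ * lsum B x l| ≤ (l.length : ℝ) * ρ := by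
  intro x l
  induction l generalizing x with
  | nil => intro _; simp [lsum]
  | cons y l ih =>
      rintro ⟨hxy, hl⟩
      rw [lsum, mul_add, List.length_cons, Nat.cast_succ, add_mul, one_mul]
      exact (abs_add_le _ _).trans (by linarith [hB x y hxy, ih y hl])

end Paths

section Box

/-! ## §6 THE POSITIVITY (1.8) FOR REGULAR NON-CONSTANT CONFIGURATIONS ON FINE BOXES

[B4] Lemma 2.1 / (2.23): on the block `□` the configuration is split as «A = A₀ + A', |A'|, |∂^η_μA'| ≤
c'e^{β−1}» with `A₀` constant (from the regularity condition (1.7)), and (2.24)–(2.26) show that «For e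
sufficiently small» the operator `H(A)` on the box stays uniformly invertible.  Here: the quadratic-form version with the explicit
constant `γ₀/4`, `γ₀ = min(2, a)` the lineage's zero-field constant (`B4Lower18.lower18_zero`). -/

open Literature.MathematicalPhysics.QuantumFieldTheory.Balaban1983to89.B4Reflection242
  (boxDom nbrs blk mem_boxDom nbrs_comm not_mem_nbrs_self blk_mem_boxDom card_nbrs)
open Literature.MathematicalPhysics.QuantumFieldTheory.Balaban1983to89.B4BoxCov237 (boxOpR)
open Literature.MathematicalPhysics.QuantumFieldTheory.Balaban1983to89.B4Lower18
  (IsBlockUnion boxDom_isBlockUnion fineOpR fineOpR_boxDom lower18_zero rblk card_filter_rblk)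

variable {X ι : Type*} {d : ℕ}

/-- the quadratic form of `K ⊗ 1_N` is the sum over colours of the forms of `K`. [folklore] -/
theorem kron_one_form [Fintype X] [Fintype ι] [DecidableEq ι] (K : Matrix X X ℝ) (Ψ : X × ι → ℝ) :
    Ψ ⬝ᵥ ((K ⊗ₖ (1 : Matrix ι ι ℝ)) *ᵥ Ψ) = ∑ i, (fun x => Ψ (x, i)) ⬝ᵥ (K *ᵥ fun x => Ψ (x, i)) := by
  simp only [dotProduct, Matrix.mulVec, Matrix.kroneckerMap_apply, Matrix.one_apply, Fintype.sum_prod_type,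
    mul_ite, mul_one, mul_zero, ite_mul, zero_mul, Finset.sum_ite_eq, Finset.mem_univ, if_true]
  exact Finset.sum_comm

/-- `|Ψ|² = Σ_i |Ψ(·, i)|²`. [folklore] -/
theorem dotProduct_eq_sum_colour [Fintype X] [Fintype ι] (Ψ : X × ι → ℝ) :
    Ψ ⬝ᵥ Ψ = ∑ i, (fun x => Ψ (x, i)) ⬝ᵥ (fun x => Ψ (x, i)) := by
  simp only [dotProduct, Fintype.sum_prod_type]
  exact Finset.sum_comm

/-- a gauge transformation preserves `|Φ|²`: `|𝒢ᵀΦ|² = |Φ|²`. [folklore] -/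
theorem gauge_transpose_dotProduct_self [Fintype X] [Fintype ι] [DecidableEq X] [DecidableEq ι]
    {g : X → Matrix ι ι ℝ} (hg : IsGauge g) (Φ : X × ι → ℝ) :
    ((blockDiag g)ᵀ *ᵥ Φ) ⬝ᵥ ((blockDiag g)ᵀ *ᵥ Φ) = Φ ⬝ᵥ Φ := by
  have h : Φ ⬝ᵥ (blockDiag g *ᵥ ((blockDiag g)ᵀ *ᵥ Φ)) = ((blockDiag g)ᵀ *ᵥ Φ) ⬝ᵥ ((blockDiag g)ᵀ *ᵥ Φ) := by
    rw [Matrix.dotProduct_mulVec, ← Matrix.mulVec_transpose]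
  rw [← h, Matrix.mulVec_mulVec, blockDiag_mul_transpose_self hg, Matrix.one_mulVec]

/-- **THE BACKGROUND BOUND**: on a fine box, [B4]'s massless operator at a CONSTANT configuration `A₀` satisfies
`⟨Φ, (−Δ_{A₀} + a n^{-(d+1)} P(A₀))Φ⟩ ≥ min(2,a)|Φ|²` — the zero-field bound (1.8) of the lineage
(`B4Lower18.lower18_zero`, `γ₀ = min(2, a)`) transported by the gauge identity `H(A₀) = 𝒢(H(0) ⊗ 1)𝒢ᵀ`
([B4] p. 581 «equivalent to the case of configuration A₀ = 0»). [cite: Balaban1983RegularityDecay, p. 573 (1.8)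
with p. 581] -/
theorem background_form_ge [Fintype ι] [DecidableEq ι] (F : OrthFlow ι) (κ : ℝ) {n : ℕ} (hn : 1 ≤ n) {a : ℝ}
    (ha : 0 ≤ a) (M : Fin (d + 1) → ℕ) {emb : ↥(boxDom M) → ↥(boxDom (fun i => n * M i))}
    {Γ : ↥(boxDom M) → ↥(boxDom (fun i => n * M i)) → List ↥(boxDom (fun i => n * M i))}
    (hend : ∀ y x, blkWt n M (fun i => n * M i) y x ≠ 0 → pathEnd (emb y) (Γ y x) = x)
    (A₀ : Fin (d + 1) → ℝ) (Φ : ↥(boxDom (fun i => n * M i)) × ι → ℝ) :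
    min 2 a * (Φ ⬝ᵥ Φ)
      ≤ Φ ⬝ᵥ (covLap (boxWt n (fun i => n * M i)) (fieldLink F κ (constBond A₀ Subtype.val)) *ᵥ Φ)
        + a * ((n : ℝ) ^ (d + 1))⁻¹
          * (Φ ⬝ᵥ (projOp (blkWt n M (fun i => n * M i))
              (contourTrans (fieldLink F κ (constBond A₀ Subtype.val)) emb Γ) *ᵥ Φ)) := by
  have hH : Φ ⬝ᵥ (covLap (boxWt n (fun i => n * M i)) (fieldLink F κ (constBond A₀ Subtype.val)) *ᵥ Φ)
        + a * ((n : ℝ) ^ (d + 1))⁻¹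
          * (Φ ⬝ᵥ (projOp (blkWt n M (fun i => n * M i))
              (contourTrans (fieldLink F κ (constBond A₀ Subtype.val)) emb Γ) *ᵥ Φ))
      = Φ ⬝ᵥ (b4Op F κ (boxWt n (fun i => n * M i)) 0 (a * ((n : ℝ) ^ (d + 1))⁻¹)
          (blkWt n M (fun i => n * M i)) emb Γ (constBond A₀ Subtype.val) *ᵥ Φ) := by
    rw [b4Op, covOp_form, zero_mul, add_zero]
  rw [hH, b4Op_constBond F κ _ 0 _ hend, scalarOp_box hn, ← fineOpR_boxDom]
  set G := blockDiag (fun u : ↥(boxDom (fun i => n * M i)) => F.U (κ * linGauge A₀ Subtype.val u)) with hG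
  have hg : IsGauge (fun u : ↥(boxDom (fun i => n * M i)) => F.U (κ * linGauge A₀ Subtype.val u)) := F.isGauge _
  rw [← Matrix.mulVec_mulVec, ← Matrix.mulVec_mulVec, Matrix.dotProduct_mulVec, ← Matrix.mulVec_transpose,
    kron_one_form, ← gauge_transpose_dotProduct_self hg Φ, ← hG, dotProduct_eq_sum_colour (Gᵀ *ᵥ Φ),
    Finset.mul_sum]
  exact Finset.sum_le_sum fun i _ => lower18_zero hn ha (boxDom_isBlockUnion hn M) _

/-- **THE SITEWISE BOUND ON `F_1`** ([B4] p. 579 (2.23) «|A'|, |∂^η_μA'| ≤ c'e^{β−1}», p. 580 «F_{1,k}(A) =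
η^{−1}(U(A) − 1)»): if `|κA'_b| ≤ θ/n` on nearest-neighbour bonds and the flow is Lipschitz,
`|(U(t) − 1)v| ≤ ℓ|t||v|`, then `Σ_y c(x,y)|E(x,y)v|² ≤ (d+1)ℓ²θ²|v|²` (`c = n²/2` per oriented bond,
`≤ 2(d+1)` neighbours). [cite: Balaban1983RegularityDecay, pp. 579–580] -/
theorem pertE_site_bound [Fintype ι] [DecidableEq ι] (F : OrthFlow ι) {ℓ : ℝ}
    (hLip : ∀ t (v : ι → ℝ), ((F.U t - 1) *ᵥ v) ⬝ᵥ ((F.U t - 1) *ᵥ v) ≤ (ℓ * t) ^ 2 * (v ⬝ᵥ v))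
    (κ : ℝ) {n : ℕ} (hn : 1 ≤ n) (N : Fin (d + 1) → ℕ) {A' : ↥(boxDom N) → ↥(boxDom N) → ℝ} {θ : ℝ}
    (hA' : ∀ x y, y.1 ∈ nbrs x.1 → |κ * A' x y| ≤ θ / n) (x : ↥(boxDom N)) (v : ι → ℝ) :
    ∑ y, boxWt n N x y * ((pertE (fieldLink F κ A') x y *ᵥ v) ⬝ᵥ (pertE (fieldLink F κ A') x y *ᵥ v))
      ≤ (d + 1) * ℓ ^ 2 * θ ^ 2 * (v ⬝ᵥ v) := by
  have hn0 : (0 : ℝ) < n := by exact_mod_cast hn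
  have hv := dotProduct_self_nonneg' v
  have hE : ∀ y, (pertE (fieldLink F κ A') x y *ᵥ v) ⬝ᵥ (pertE (fieldLink F κ A') x y *ᵥ v)
      = ((F.U (-(κ * A' x y)) - 1) *ᵥ v) ⬝ᵥ ((F.U (-(κ * A' x y)) - 1) *ᵥ v) := by
    intro y
    simp only [pertE, fieldLink, F.transpose_eq]
    rw [← neg_sub, Matrix.neg_mulVec, neg_dotProduct, dotProduct_neg, neg_neg]
  have hterm : ∀ y, y.1 ∈ nbrs x.1 →
      (pertE (fieldLink F κ A') x y *ᵥ v) ⬝ᵥ (pertE (fieldLink F κ A') x y *ᵥ v)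
        ≤ ℓ ^ 2 * (θ / n) ^ 2 * (v ⬝ᵥ v) := by
    intro y hy
    rw [hE]
    refine (hLip _ v).trans ?_
    have h1 : (κ * A' x y) ^ 2 ≤ (θ / n) ^ 2 := by
      rw [← sq_abs]
      exact pow_le_pow_left₀ (abs_nonneg _) (hA' x y hy) 2
    have h2 : (ℓ * -(κ * A' x y)) ^ 2 = ℓ ^ 2 * (κ * A' x y) ^ 2 := by ring
    rw [h2]
    exact mul_le_mul_of_nonneg_right (mul_le_mul_of_nonneg_left h1 (sq_nonneg ℓ)) hv
  have hwt : ∀ y, 0 ≤ boxWt n N x y := fun y => by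
    unfold boxWt
    split_ifs <;> positivity
  calc ∑ y, boxWt n N x y * ((pertE (fieldLink F κ A') x y *ᵥ v) ⬝ᵥ (pertE (fieldLink F κ A') x y *ᵥ v))
      ≤ ∑ y, boxWt n N x y * (ℓ ^ 2 * (θ / n) ^ 2 * (v ⬝ᵥ v)) := by
        refine Finset.sum_le_sum fun y _ => ?_
        by_cases hy : y.1 ∈ nbrs x.1
        · exact mul_le_mul_of_nonneg_left (hterm y hy) (hwt y)
        · simp [boxWt, hy]
    _ = (n : ℝ) ^ 2 / 2 * (((nbrs x.1).filter fun w => w ∈ boxDom N).card : ℝ)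
          * (ℓ ^ 2 * (θ / n) ^ 2 * (v ⬝ᵥ v)) := by rw [← Finset.sum_mul, sum_boxWt_right]
    _ ≤ (n : ℝ) ^ 2 / 2 * ((2 * (d + 1) : ℕ) : ℝ) * (ℓ ^ 2 * (θ / n) ^ 2 * (v ⬝ᵥ v)) := by
        have hc : (((nbrs x.1).filter fun w => w ∈ boxDom N).card : ℝ) ≤ ((2 * (d + 1) : ℕ) : ℝ) := by
          rw [← card_nbrs x.1]
          exact_mod_cast Finset.card_filter_le _ _
        have h0 : 0 ≤ ℓ ^ 2 * (θ / n) ^ 2 * (v ⬝ᵥ v) := by positivity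
        exact mul_le_mul_of_nonneg_right (mul_le_mul_of_nonneg_left hc (by positivity)) h0
    _ = (d + 1) * ℓ ^ 2 * θ ^ 2 * (v ⬝ᵥ v) := by
        push_cast
        field_simp

/-- **THE BOUND ON THE TRANSPORT PERTURBATION** `F'_{1,k}(A'(Γ^{(k)}_{y,x})) = U(A'(Γ^{(k)}_{y,x})) − 1`
([B4] p. 580 «F'_{1,k}(A) = U(A) − 1»): along a nearest-neighbour contour of length `≤ (d+1)n`,
`|κA'(Γ)| ≤ (d+1)θ`, hence `|(U(κA'(Γ)) − 1)v|² ≤ (ℓ(d+1)θ)²|v|²`. [cite: Balaban1983RegularityDecay, p. 579] -/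
theorem pertT_bound [Fintype ι] [DecidableEq ι] (F : OrthFlow ι) {ℓ : ℝ} (hℓ : 0 ≤ ℓ)
    (hLip : ∀ t (v : ι → ℝ), ((F.U t - 1) *ᵥ v) ⬝ᵥ ((F.U t - 1) *ᵥ v) ≤ (ℓ * t) ^ 2 * (v ⬝ᵥ v))
    (κ : ℝ) {n : ℕ} (hn : 1 ≤ n) (N : Fin (d + 1) → ℕ) {A' : ↥(boxDom N) → ↥(boxDom N) → ℝ} {θ : ℝ}
    (hθ : 0 ≤ θ) (hA' : ∀ x y, y.1 ∈ nbrs x.1 → |κ * A' x y| ≤ θ / n) {x₀ : ↥(boxDom N)} {l : List ↥(boxDom N)}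
    (hl : PathRel (fun u v : ↥(boxDom N) => v.1 ∈ nbrs u.1) x₀ l) (hlen : (l.length : ℝ) ≤ (d + 1) * n)
    (v : ι → ℝ) :
    ((transport (fieldLink F κ A') x₀ l - 1) *ᵥ v) ⬝ᵥ ((transport (fieldLink F κ A') x₀ l - 1) *ᵥ v)
      ≤ (ℓ * ((d + 1) * θ)) ^ 2 * (v ⬝ᵥ v) := by
  have hn0 : (0 : ℝ) < n := by exact_mod_cast hn
  rw [transport_fieldLink]
  refine (hLip _ v).trans (mul_le_mul_of_nonneg_right ?_ (dotProduct_self_nonneg' v))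
  have h1 : |κ * lsum A' x₀ l| ≤ (d + 1) * θ := by
    refine (abs_lsum_le (r := fun u v : ↥(boxDom N) => v.1 ∈ nbrs u.1) hA' x₀ l hl).trans ?_
    calc (l.length : ℝ) * (θ / n) ≤ (d + 1) * n * (θ / n) :=
          mul_le_mul_of_nonneg_right hlen (div_nonneg hθ hn0.le)
      _ = (d + 1) * θ := by field_simp
  have h2 : |ℓ * (κ * lsum A' x₀ l)| ≤ ℓ * ((d + 1) * θ) := by
    rw [abs_mul, abs_of_nonneg hℓ]
    exact mul_le_mul_of_nonneg_left h1 hℓ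
  exact sq_le_sq' (by linarith [abs_nonneg (ℓ * (κ * lsum A' x₀ l)), neg_abs_le (ℓ * (κ * lsum A' x₀ l))])
    (le_of_abs_le h2)

/-- the row sums of the block weights: every unit block contains at most `n^{d+1}` fine box points. [folklore] -/
theorem sum_blkWt_row {n : ℕ} (hn : 1 ≤ n) (M : Fin (d + 1) → ℕ) (y : ↥(boxDom M)) :
    ∑ x, blkWt n M (fun i => n * M i) y x ≤ (n : ℝ) ^ (d + 1) := by
  unfold blkWt
  rw [Finset.sum_boole]
  by_cases h : ∃ x : ↥(boxDom (fun i => n * M i)), blk n x.1 = y.1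
  · obtain ⟨x₀, hx₀⟩ := h
    have hy : y.1 ∈ (boxDom (fun i => n * M i)).image (blk n) := Finset.mem_image.2 ⟨x₀.1, x₀.2, hx₀⟩
    have heq : (Finset.univ.filter fun x : ↥(boxDom (fun i => n * M i)) => blk n x.1 = y.1)
        = Finset.univ.filter fun x => rblk n (boxDom (fun i => n * M i)) x = ⟨y.1, hy⟩ := by
      ext x
      simp only [Finset.mem_filter, Finset.mem_univ, true_and, rblk, Subtype.ext_iff]
    rw [heq, card_filter_rblk hn (boxDom_isBlockUnion hn M)]
    push_cast
    exact le_rfl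
  · have heq : (Finset.univ.filter fun x : ↥(boxDom (fun i => n * M i)) => blk n x.1 = y.1) = ∅ := by
      ext x
      simp only [Finset.mem_filter, Finset.mem_univ, true_and, Finset.notMem_empty, iff_false]
      exact fun hx => h ⟨x, hx⟩
    rw [heq, Finset.card_empty, Nat.cast_zero]
    positivity

/-- the column sums of the block weights: every fine point lies in at most one unit block. [folklore] -/
theorem sum_blkWt_col (n : ℕ) (M N : Fin (d + 1) → ℕ) (x : ↥(boxDom N)) : ∑ y, blkWt n M N y x ≤ 1 := by
  unfold blkWt
  rw [Finset.sum_coe_sort (s := boxDom M) (f := fun w => if blk n x.1 = w then (1 : ℝ) else 0),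
    Finset.sum_ite_eq]
  split_ifs <;> norm_num

/-- **THEOREM ((1.8) FOR REGULAR NON-CONSTANT CONFIGURATIONS ON FINE BOXES, EXPLICIT CONSTANTS)** — the
kernel-checked content of [B4] Lemma 2.1's setting (2.23)–(2.26) at the level of quadratic forms: on the fine box
`Π_μ[0, n·M_μ)` (`n = L^k` points per unit length, Neumann bonds, `a·n^{-(d+1)}P_k`), for ANY configuration `A`
whose deviation from a constant `A₀` satisfies `|κ(A − A₀)_b| ≤ θ/n` on nearest-neighbour bonds (the printed
(2.23) «|A'|, |∂^η_μA'| ≤ c'e^{β−1}» with `κ = eη`, `θ = c'e^β`), and smallness `ℓ²θ²(d+1)(1 + a(d+1)) ≤ min(2,a)/4`,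
`⟨Φ, (−Δ^{η,N}_{A,□} + m² + aP_k(A))Φ⟩ ≥ (min(2,a)/4 + m²)|Φ|²`.  HONEST LABEL: [B4] states (1.8) for all
regular `A` on arbitrary `Ω` with an unspecified `γ₀`; this is the box case about a constant background, with the
explicit `γ₀/4`. [cite: Balaban1983RegularityDecay, p. 573 (1.8) with pp. 579–580 (2.23)–(2.26)] -/
theorem lower18_regular_box [Fintype ι] [DecidableEq ι] (F : OrthFlow ι) {ℓ : ℝ} (hℓ : 0 ≤ ℓ)
    (hLip : ∀ t (v : ι → ℝ), ((F.U t - 1) *ᵥ v) ⬝ᵥ ((F.U t - 1) *ᵥ v) ≤ (ℓ * t) ^ 2 * (v ⬝ᵥ v))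
    (κ : ℝ) {n : ℕ} (hn : 1 ≤ n) {a : ℝ} (ha : 0 ≤ a) (m2 : ℝ) (M : Fin (d + 1) → ℕ)
    {emb : ↥(boxDom M) → ↥(boxDom (fun i => n * M i))}
    {Γ : ↥(boxDom M) → ↥(boxDom (fun i => n * M i)) → List ↥(boxDom (fun i => n * M i))}
    (hend : ∀ y x, blkWt n M (fun i => n * M i) y x ≠ 0 → pathEnd (emb y) (Γ y x) = x)
    (hnn : ∀ y x, blkWt n M (fun i => n * M i) y x ≠ 0 →
      PathRel (fun u v : ↥(boxDom (fun i => n * M i)) => v.1 ∈ nbrs u.1) (emb y) (Γ y x))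
    (hlen : ∀ y x, blkWt n M (fun i => n * M i) y x ≠ 0 → ((Γ y x).length : ℝ) ≤ (d + 1) * n)
    (A₀ : Fin (d + 1) → ℝ) {A : ↥(boxDom (fun i => n * M i)) → ↥(boxDom (fun i => n * M i)) → ℝ} {θ : ℝ}
    (hθ : 0 ≤ θ) (hA : ∀ x y, y.1 ∈ nbrs x.1 → |κ * (A x y - constBond A₀ Subtype.val x y)| ≤ θ / n)
    (hsmall : ℓ ^ 2 * θ ^ 2 * (d + 1) * (1 + a * (d + 1)) ≤ min 2 a / 4)
    (Φ : ↥(boxDom (fun i => n * M i)) × ι → ℝ) :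
    (min 2 a / 4 + m2) * (Φ ⬝ᵥ Φ)
      ≤ Φ ⬝ᵥ (b4Op F κ (boxWt n (fun i => n * M i)) m2 (a * ((n : ℝ) ^ (d + 1))⁻¹)
          (blkWt n M (fun i => n * M i)) emb Γ A *ᵥ Φ) := by
  have hn0 : (0 : ℝ) < n := by exact_mod_cast hn
  have hnd : (0 : ℝ) < (n : ℝ) ^ (d + 1) := pow_pos hn0 _
  have hsplit : A = constBond A₀ Subtype.val + (A - constBond A₀ Subtype.val) := (add_sub_cancel _ _).symm
  have hcomm : ∀ p q u v : ↥(boxDom (fun i => n * M i)),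
      fieldLink F κ (constBond A₀ Subtype.val) p q * fieldLink F κ (A - constBond A₀ Subtype.val) u v
        = fieldLink F κ (A - constBond A₀ Subtype.val) u v * fieldLink F κ (constBond A₀ Subtype.val) p q :=
    fun p q u v => F.comm _ _
  rw [hsplit, b4Op, fieldLink_add, contourTrans_kmul hcomm]
  have hwt : ∀ x y, 0 ≤ boxWt n (fun i => n * M i) x y := fun x y => by
    unfold boxWt
    split_ifs <;> positivity
  have hq : ∀ y x, 0 ≤ blkWt n M (fun i => n * M i) y x := fun y x => by
    unfold blkWt
    split_ifs <;> norm_num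
  refine covOp_kmul_form_ge_quarter hwt m2 (mul_nonneg ha (inv_nonneg.2 hnd.le)) _
    (fieldLink_orth F κ _) _ _ _ (γ₀ := min 2 a) (ε₁ := (d + 1) * ℓ ^ 2 * θ ^ 2)
    (ε₂ := (n : ℝ) ^ (d + 1) * 1 * (ℓ * ((d + 1) * θ)) ^ 2)
    (background_form_ge F κ hn ha M hend A₀) ?_ ?_ ?_ Φ
  · exact pertE_form_le (pertE_site_bound F hLip κ hn _ hA)
  · intro Ψ
    refine pertF_form_le hq hnd.le (by positivity) (sum_blkWt_row hn M) (sum_blkWt_col n M _) ?_ ?_ Ψ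
    · intro y x
      rw [contourTrans, transport_fieldLink]
      exact F.orth _
    · intro y x v hyx
      exact pertT_bound F hℓ hLip κ hn _ hθ hA (hnn y x hyx) (hlen y x hyx) v
  · have : (d + 1) * ℓ ^ 2 * θ ^ 2 + a * ((n : ℝ) ^ (d + 1))⁻¹ * ((n : ℝ) ^ (d + 1) * 1 * (ℓ * ((d + 1) * θ)) ^ 2)
        = ℓ ^ 2 * θ ^ 2 * (d + 1) * (1 + a * (d + 1)) := by
      field_simp
    rw [this]
    exact hsmall

end Box

section Charge

/-! ## §7 THE PRINTED PARAMETRISATION: charge `e`, `U(A_b) = exp(qeηA_b)`, regularity `|A'| ≤ c'e^{β−1}`, threshold `e ≤ e₁`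

In lattice units (sites of the fine box = points of `ηℤ^d ∩ □`, `η = n^{-1}`) the link variable (1.2) is
`U(A_b) = exp(q·eη·A_b)`, i.e. `κ = e/n`, and (2.23) «A = A₀ + A', |A'|, |∂^η_μA'| ≤ c'e^{β−1}» gives
`|κA'_b| ≤ c'e^β/n`, i.e. `θ = c'e^β`; the smallness `ℓ²θ²(d+1)(1+a(d+1)) ≤ min(2,a)/4` then holds for all
`0 < e ≤ e₁`, an explicit threshold. -/

open Literature.MathematicalPhysics.QuantumFieldTheory.Balaban1983to89.B4Reflection242 (boxDom nbrs blk)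

variable {ι : Type*} {d : ℕ}

/-- `e^β = e^{β−1}·e` for `e > 0`. [folklore] -/
theorem rpow_eq_rpow_sub_one_mul {e : ℝ} (he : 0 < e) (β : ℝ) : e ^ β = e ^ (β - 1) * e := by
  conv_lhs => rw [← sub_add_cancel β 1]
  rw [Real.rpow_add he, Real.rpow_one]

/-- **(1.8) ON FINE BOXES IN THE PRINTED PARAMETRISATION**: charge `e > 0`, `κ = eη = e/n`, a configuration with
«A = A₀ + A', |A'|, |∂^η_μA'| ≤ c'e^{β−1}» (only the bound on `|A'|` is used), and the smallness
`ℓ²(c'e^β)²(d+1)(1+a(d+1)) ≤ min(2,a)/4`; then `−Δ^{η,N}_{A,□} + m² + aP_k(A) ≥ (min(2,a)/4 + m²)I` as forms.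
[cite: Balaban1983RegularityDecay, p. 573 (1.8) with p. 579 (2.23)] -/
theorem lower18_regular_box_charge [Fintype ι] [DecidableEq ι] (F : OrthFlow ι) {ℓ : ℝ} (hℓ : 0 ≤ ℓ)
    (hLip : ∀ t (v : ι → ℝ), ((F.U t - 1) *ᵥ v) ⬝ᵥ ((F.U t - 1) *ᵥ v) ≤ (ℓ * t) ^ 2 * (v ⬝ᵥ v))
    {e : ℝ} (he : 0 < e) {n : ℕ} (hn : 1 ≤ n) {a : ℝ} (ha : 0 ≤ a) (m2 : ℝ) (M : Fin (d + 1) → ℕ)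
    {emb : ↥(boxDom M) → ↥(boxDom (fun i => n * M i))}
    {Γ : ↥(boxDom M) → ↥(boxDom (fun i => n * M i)) → List ↥(boxDom (fun i => n * M i))}
    (hend : ∀ y x, blkWt n M (fun i => n * M i) y x ≠ 0 → pathEnd (emb y) (Γ y x) = x)
    (hnn : ∀ y x, blkWt n M (fun i => n * M i) y x ≠ 0 →
      PathRel (fun u v : ↥(boxDom (fun i => n * M i)) => v.1 ∈ nbrs u.1) (emb y) (Γ y x))
    (hlen : ∀ y x, blkWt n M (fun i => n * M i) y x ≠ 0 → ((Γ y x).length : ℝ) ≤ (d + 1) * n)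
    (A₀ : Fin (d + 1) → ℝ) {A : ↥(boxDom (fun i => n * M i)) → ↥(boxDom (fun i => n * M i)) → ℝ}
    {c' β : ℝ} (hc' : 0 ≤ c')
    (hreg : ∀ x y, y.1 ∈ nbrs x.1 → |A x y - constBond A₀ Subtype.val x y| ≤ c' * e ^ (β - 1))
    (hsmall : ℓ ^ 2 * (c' * e ^ β) ^ 2 * (d + 1) * (1 + a * (d + 1)) ≤ min 2 a / 4)
    (Φ : ↥(boxDom (fun i => n * M i)) × ι → ℝ) :
    (min 2 a / 4 + m2) * (Φ ⬝ᵥ Φ)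
      ≤ Φ ⬝ᵥ (b4Op F (e / n) (boxWt n (fun i => n * M i)) m2 (a * ((n : ℝ) ^ (d + 1))⁻¹)
          (blkWt n M (fun i => n * M i)) emb Γ A *ᵥ Φ) := by
  have hn0 : (0 : ℝ) < n := by exact_mod_cast hn
  have hθ : 0 ≤ c' * e ^ β := mul_nonneg hc' (Real.rpow_nonneg he.le β)
  refine lower18_regular_box F hℓ hLip (e / n) hn ha m2 M hend hnn hlen A₀ hθ ?_ (by simpa using hsmall) Φ
  intro x y hxy
  rw [abs_mul, abs_of_pos (div_pos he hn0)]
  calc e / n * |A x y - constBond A₀ Subtype.val x y| ≤ e / n * (c' * e ^ (β - 1)) :=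
        mul_le_mul_of_nonneg_left (hreg x y hxy) (div_pos he hn0).le
    _ = c' * e ^ β / n := by rw [rpow_eq_rpow_sub_one_mul he β]; ring

/-- **THE THRESHOLD `e₁`** («for e sufficiently small», p. 573/580): for `a > 0`, `β > 0` there is `e₁ > 0` with
`ℓ²(c'e^β)²(d+1)(1+a(d+1)) ≤ min(2,a)/4` for all `0 < e ≤ e₁`; explicitly `e₁ = s^{1/β}`,
`s = min(1, γ/(C+1))`, `γ = min(2,a)/4`, `C = ℓ²c'²(d+1)(1+a(d+1))`. [folklore] -/
theorem threshold_exists (ℓ c' : ℝ) {a : ℝ} (ha : 0 < a) {β : ℝ} (hβ : 0 < β) (d : ℕ) :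
    ∃ e₁ : ℝ, 0 < e₁ ∧ ∀ e : ℝ, 0 < e → e ≤ e₁ →
      ℓ ^ 2 * (c' * e ^ β) ^ 2 * (d + 1) * (1 + a * (d + 1)) ≤ min 2 a / 4 := by
  set γ : ℝ := min 2 a / 4 with hγ
  set C : ℝ := ℓ ^ 2 * c' ^ 2 * (d + 1) * (1 + a * (d + 1)) with hC
  have hγ0 : 0 < γ := by rw [hγ]; exact div_pos (lt_min two_pos ha) four_pos
  have hC0 : 0 ≤ C := by rw [hC]; positivity
  set s : ℝ := min 1 (γ / (C + 1)) with hs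
  have hs0 : 0 < s := lt_min one_pos (div_pos hγ0 (by linarith))
  have hs1 : s ≤ 1 := min_le_left _ _
  have hsC : s ≤ γ / (C + 1) := min_le_right _ _
  refine ⟨s ^ (1 / β), Real.rpow_pos_of_pos hs0 _, fun e he hle => ?_⟩
  have heβ : e ^ β ≤ s := by
    have h := Real.rpow_le_rpow he.le hle hβ.le
    rwa [← Real.rpow_mul hs0.le, one_div_mul_cancel hβ.ne', Real.rpow_one] at h
  have heβ0 : 0 ≤ e ^ β := Real.rpow_nonneg he.le β
  have h1 : (e ^ β) ^ 2 ≤ s := by nlinarith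
  have h2 : C * s ≤ γ := by
    calc C * s ≤ C * (γ / (C + 1)) := mul_le_mul_of_nonneg_left hsC hC0
      _ ≤ γ := by
          rw [mul_div_assoc', div_le_iff₀ (by linarith)]
          nlinarith
  calc ℓ ^ 2 * (c' * e ^ β) ^ 2 * (d + 1) * (1 + a * (d + 1)) = C * (e ^ β) ^ 2 := by rw [hC]; ring
    _ ≤ C * s := mul_le_mul_of_nonneg_left h1 hC0
    _ ≤ γ := h2

/-- **A LIPSCHITZ WITNESS FOR THE FLOW HYPOTHESIS** (`N = 2`, `q` = the rotation generator, `ℓ = 1`):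
`|(R(t) − 1)v|² = (2 − 2cos t)|v|² ≤ t²|v|²`. [folklore] -/
theorem rot_lipschitz (t : ℝ) (v : Fin 2 → ℝ) :
    ((OrthFlow.rot.U t - 1) *ᵥ v) ⬝ᵥ ((OrthFlow.rot.U t - 1) *ᵥ v) ≤ (1 * t) ^ 2 * (v ⬝ᵥ v) := by
  have hc := Real.one_sub_sq_div_two_le_cos (x := t)
  have hsc := Real.sin_sq_add_cos_sq t
  have hv : 0 ≤ v 0 ^ 2 + v 1 ^ 2 := by positivity
  have key : (2 - 2 * Real.cos t) * (v 0 ^ 2 + v 1 ^ 2) ≤ t ^ 2 * (v 0 ^ 2 + v 1 ^ 2) :=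
    mul_le_mul_of_nonneg_right (by linarith) hv
  have h2 : (Real.sin t ^ 2 + Real.cos t ^ 2) * (v 0 ^ 2 + v 1 ^ 2) = v 0 ^ 2 + v 1 ^ 2 := by
    rw [hsc, one_mul]
  have hmv : (OrthFlow.rot.U t - 1) *ᵥ v
      = ![(Real.cos t - 1) * v 0 - Real.sin t * v 1, Real.sin t * v 0 + (Real.cos t - 1) * v 1] := by
    ext i
    fin_cases i <;> simp [OrthFlow.rot, Matrix.mulVec, dotProduct, Fin.sum_univ_two, Matrix.one_apply]
    ring
  rw [hmv]
  simp only [dotProduct, Fin.sum_univ_two, Matrix.cons_val_zero, Matrix.cons_val_one]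
  nlinarith [key, h2]

end Charge

section Stair

/-! ## §8 THE CONTOURS `Γ^{(k)}_{y,x}`: staircase paths inside a block (a witness for the contour hypotheses)

[B4] p. 572: `Γ^{(k)}_{y,x}` are oriented contours in `B^k(y)` from `y` to `x`.  We construct the axis-by-axis
staircase from the base corner `n·y` of the block to `x` and check the three hypotheses of `lower18_regular_box`:
it ends at `x`, its steps are nearest-neighbour bonds inside the box, and its length is `≤ (d+1)·n`. -/

open Literature.MathematicalPhysics.QuantumFieldTheory.Balaban1983to89.B4Reflection242
  (boxDom nbrs blk mem_boxDom mem_nbrs)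

variable {X : Type*} {d : ℕ}

/-- end point of a concatenated contour. [folklore] -/
theorem pathEnd_append (x : X) (l₁ l₂ : List X) : pathEnd x (l₁ ++ l₂) = pathEnd (pathEnd x l₁) l₂ := by
  induction l₁ generalizing x with
  | nil => rfl
  | cons y l ih => exact ih y

/-- step relation of a concatenated contour. [folklore] -/
theorem pathRel_append {r : X → X → Prop} (x : X) (l₁ l₂ : List X) :
    PathRel r x (l₁ ++ l₂) ↔ PathRel r x l₁ ∧ PathRel r (pathEnd x l₁) l₂ := by
  induction l₁ generalizing x with
  | nil => simp [PathRel, pathEnd]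
  | cons y l ih => simp [PathRel, pathEnd, ih, and_assoc]

/-- end point of a contour of subtype points = end point of the underlying contour. [folklore] -/
theorem val_pathEnd_pmap {P : X → Prop} (l : List X) (p : X) (hp : P p) (h : ∀ z ∈ l, P z) :
    (pathEnd (⟨p, hp⟩ : Subtype P) (l.pmap Subtype.mk h)).1 = pathEnd p l := by
  induction l generalizing p with
  | nil => rfl
  | cons a l ih => exact ih a (h a (by simp)) _

/-- step relation of a contour of subtype points = that of the underlying contour. [folklore] -/
theorem pathRel_pmap_iff {P : X → Prop} {r : X → X → Prop} (l : List X) (p : X) (hp : P p)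
    (h : ∀ z ∈ l, P z) :
    PathRel (fun u v : Subtype P => r u.1 v.1) ⟨p, hp⟩ (l.pmap Subtype.mk h) ↔ PathRel r p l := by
  induction l generalizing p with
  | nil => simp [PathRel]
  | cons a l ih => exact and_congr Iff.rfl (ih a (h a (by simp)) _)

/-- the unit vector `e_i` of `ℤ^{d+1}`. [folklore] -/
def e1 (i : Fin (d + 1)) : Fin (d + 1) → ℤ := Pi.single i 1

/-- the `i`-th coordinate of `e_i` is `1`. [folklore] -/
@[simp] theorem e1_apply_self (i : Fin (d + 1)) : e1 i i = 1 := by simp [e1]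

/-- the other coordinates of `e_i` vanish. [folklore] -/
theorem e1_apply_ne {i k : Fin (d + 1)} (h : k ≠ i) : e1 i k = 0 := by simp [e1, h]

/-- coordinates of `p + j·e_i`. [folklore] -/
theorem add_nsmul_e1_apply (p : Fin (d + 1) → ℤ) (i : Fin (d + 1)) (j : ℕ) (k : Fin (d + 1)) :
    (p + j • e1 i) k = if k = i then p k + j else p k := by
  by_cases hk : k = i
  · subst hk; simp [nsmul_eq_mul]
  · simp [hk, e1_apply_ne hk]

/-- the straight segment of `m` unit steps in direction `i` starting after `p`. [folklore] -/
def seg (i : Fin (d + 1)) : (Fin (d + 1) → ℤ) → ℕ → List (Fin (d + 1) → ℤ)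
  | _, 0 => []
  | p, m + 1 => (p + e1 i) :: seg i (p + e1 i) m

/-- a segment of `m` steps has length `m`. [folklore] -/
theorem length_seg (i : Fin (d + 1)) (p : Fin (d + 1) → ℤ) (m : ℕ) : (seg i p m).length = m := by
  induction m generalizing p with
  | zero => rfl
  | succ m ih => simp [seg, ih]

/-- a segment of `m` steps in direction `i` ends at `p + m·e_i`. [folklore] -/
theorem pathEnd_seg (i : Fin (d + 1)) (p : Fin (d + 1) → ℤ) (m : ℕ) :
    pathEnd p (seg i p m) = p + m • e1 i := by
  induction m generalizing p with
  | zero => simp [seg, pathEnd]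
  | succ m ih => rw [seg, pathEnd, ih, succ_nsmul', add_assoc]

/-- the steps of a segment are nearest-neighbour bonds. [folklore] -/
theorem pathRel_seg (i : Fin (d + 1)) (p : Fin (d + 1) → ℤ) (m : ℕ) :
    PathRel (fun u v => v ∈ nbrs u) p (seg i p m) := by
  induction m generalizing p with
  | zero => trivial
  | succ m ih => exact ⟨mem_nbrs.2 ⟨i, Or.inl rfl⟩, ih _⟩

/-- the points of a segment are `p + j·e_i`, `j ≤ m`. [folklore] -/
theorem mem_seg {i : Fin (d + 1)} {p z : Fin (d + 1) → ℤ} {m : ℕ} (hz : z ∈ seg i p m) :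
    ∃ j : ℕ, j ≤ m ∧ z = p + j • e1 i := by
  induction m generalizing p with
  | zero => simp [seg] at hz
  | succ m ih =>
      simp only [seg, List.mem_cons] at hz
      rcases hz with rfl | hz
      · exact ⟨1, by omega, by simp⟩
      · obtain ⟨j, hj, rfl⟩ := ih hz
        exact ⟨j + 1, by omega, by rw [succ_nsmul', ← add_assoc]⟩

/-- `p` with coordinate `i` raised to `x i`. [folklore] -/
def raise (x p : Fin (d + 1) → ℤ) (i : Fin (d + 1)) : Fin (d + 1) → ℤ := p + (x i - p i).toNat • e1 i

/-- the raised coordinate equals `x i`. [folklore] -/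
theorem raise_apply_self {x p : Fin (d + 1) → ℤ} (hp : p ≤ x) (i : Fin (d + 1)) : raise x p i i = x i := by
  rw [raise, add_nsmul_e1_apply, if_pos rfl, Int.toNat_of_nonneg (sub_nonneg.2 (hp i))]
  ring

/-- raising coordinate `i` does not move the other coordinates. [folklore] -/
theorem raise_apply_ne (x p : Fin (d + 1) → ℤ) {i k : Fin (d + 1)} (h : k ≠ i) : raise x p i k = p k := by
  rw [raise, add_nsmul_e1_apply, if_neg h]

/-- raising a coordinate towards `x ≥ p` moves up. [folklore] -/
theorem le_raise {x p : Fin (d + 1) → ℤ} (hp : p ≤ x) (i : Fin (d + 1)) : p ≤ raise x p i := by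
  intro k
  by_cases hk : k = i
  · subst hk; rw [raise_apply_self hp]; exact hp k
  · rw [raise_apply_ne x p hk]

/-- raising a coordinate towards `x ≥ p` stays below `x`. [folklore] -/
theorem raise_le {x p : Fin (d + 1) → ℤ} (hp : p ≤ x) (i : Fin (d + 1)) : raise x p i ≤ x := by
  intro k
  by_cases hk : k = i
  · subst hk; rw [raise_apply_self hp]
  · rw [raise_apply_ne x p hk]; exact hp k

/-- the staircase from `p` to `x` through the coordinate list `cs` (each coordinate raised to `x`'s value in
turn). [folklore] -/
def stairL (x : Fin (d + 1) → ℤ) : (Fin (d + 1) → ℤ) → List (Fin (d + 1)) → List (Fin (d + 1) → ℤ)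
  | _, [] => []
  | p, i :: cs => seg i p (x i - p i).toNat ++ stairL x (raise x p i) cs

/-- the segment of the staircase in direction `i` ends at the raised point. [folklore] -/
theorem pathEnd_seg_raise (x p : Fin (d + 1) → ℤ) (i : Fin (d + 1)) :
    pathEnd p (seg i p (x i - p i).toNat) = raise x p i :=
  pathEnd_seg i p _

/-- the staircase through the coordinates `cs` ends at `x` on `cs` and at `p` elsewhere. [folklore] -/
theorem pathEnd_stairL (x : Fin (d + 1) → ℤ) (cs : List (Fin (d + 1))) :
    ∀ p, p ≤ x → pathEnd p (stairL x p cs) = fun j => if j ∈ cs then x j else p j := by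
  induction cs with
  | nil => intro p _; funext j; simp [stairL, pathEnd]
  | cons i cs ih =>
      intro p hp
      rw [stairL, pathEnd_append, pathEnd_seg_raise, ih _ (raise_le hp i)]
      funext j
      by_cases hj : j ∈ cs
      · simp [hj]
      · by_cases hji : j = i
        · subst hji; simp [hj, raise_apply_self hp]
        · simp [hj, hji, raise_apply_ne x p hji]

/-- the steps of the staircase are nearest-neighbour bonds. [folklore] -/
theorem pathRel_stairL (x : Fin (d + 1) → ℤ) (cs : List (Fin (d + 1))) :
    ∀ p, p ≤ x → PathRel (fun u v => v ∈ nbrs u) p (stairL x p cs) := by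
  induction cs with
  | nil => intro p _; trivial
  | cons i cs ih =>
      intro p hp
      rw [stairL, pathRel_append, pathEnd_seg_raise]
      exact ⟨pathRel_seg i p _, ih _ (raise_le hp i)⟩

/-- the staircase through `cs` has length `≤ |cs|·K` if every displacement is `≤ K`. [folklore] -/
theorem length_stairL_le {u x : Fin (d + 1) → ℤ} {K : ℤ} (hK : ∀ j, x j - u j ≤ K) (cs : List (Fin (d + 1))) :
    ∀ p, u ≤ p → p ≤ x → ((stairL x p cs).length : ℤ) ≤ cs.length * K := by
  induction cs with
  | nil => intro p _ _; simp [stairL]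
  | cons i cs ih =>
      intro p hu hp
      rw [stairL, List.length_append, length_seg, List.length_cons]
      have hm : ((x i - p i).toNat : ℤ) ≤ K := by
        rw [Int.toNat_of_nonneg (sub_nonneg.2 (hp i))]
        linarith [hu i, hK i]
      have := ih _ (le_trans hu (le_raise hp i)) (raise_le hp i)
      push_cast
      linarith

/-- the staircase stays in the order interval `[u, x]`. [folklore] -/
theorem mem_stairL {u x : Fin (d + 1) → ℤ} (cs : List (Fin (d + 1))) :
    ∀ p, u ≤ p → p ≤ x → ∀ z ∈ stairL x p cs, u ≤ z ∧ z ≤ x := by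
  induction cs with
  | nil => intro p _ _ z hz; simp [stairL] at hz
  | cons i cs ih =>
      intro p hu hp z hz
      rw [stairL, List.mem_append] at hz
      rcases hz with hz | hz
      · obtain ⟨j, hj, rfl⟩ := mem_seg hz
        have hi : 0 ≤ x i - p i := sub_nonneg.2 (hp i)
        have hj' : (j : ℤ) ≤ x i - p i := by
          have : (j : ℤ) ≤ ((x i - p i).toNat : ℤ) := by exact_mod_cast hj
          rwa [Int.toNat_of_nonneg hi] at this
        refine ⟨fun k => ?_, fun k => ?_⟩
        · rw [add_nsmul_e1_apply]
          split_ifs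
          · linarith [hu k]
          · exact hu k
        · rw [add_nsmul_e1_apply]
          split_ifs with hk
          · subst hk; linarith
          · exact hp k
      · exact ih _ (le_trans hu (le_raise hp i)) (raise_le hp i) z hz

/-- a product box is order-convex. [folklore] -/
theorem mem_boxDom_of_between {N : Fin (d + 1) → ℕ} {u x z : Fin (d + 1) → ℤ} (hu : u ∈ boxDom N)
    (hx : x ∈ boxDom N) (h1 : u ≤ z) (h2 : z ≤ x) : z ∈ boxDom N := by
  rw [mem_boxDom] at hu hx ⊢
  exact fun i => ⟨(hu i).1.trans (h1 i), (h2 i).trans_lt (hx i).2⟩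

/-- **THE STAIRCASE CONTOUR** `Γ_{y,x}`: from the base corner `n·y` of the block `B(y)` to `x ∈ B(y)`, all
coordinates raised in turn. [cite: Balaban1983RegularityDecay, p. 572 «Γ^{(k)}_{y,x}»] -/
def stair (u x : Fin (d + 1) → ℤ) : List (Fin (d + 1) → ℤ) := stairL x u (List.finRange (d + 1))

/-- the staircase from `u` to `x ≥ u` ends at `x`. [folklore] -/
theorem pathEnd_stair {u x : Fin (d + 1) → ℤ} (h : u ≤ x) : pathEnd u (stair u x) = x := by
  rw [stair, pathEnd_stairL x _ u h]
  funext j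
  simp

/-- the steps of the staircase from `u` to `x ≥ u` are nearest-neighbour bonds. [folklore] -/
theorem pathRel_stair {u x : Fin (d + 1) → ℤ} (h : u ≤ x) : PathRel (fun u v => v ∈ nbrs u) u (stair u x) :=
  pathRel_stairL x _ u h

/-- the staircase from `u` to `x` has length `≤ (d+1)·K` if `x_j − u_j ≤ K` for all `j`. [folklore] -/
theorem length_stair_le {u x : Fin (d + 1) → ℤ} (h : u ≤ x) {K : ℤ} (hK : ∀ j, x j - u j ≤ K) :
    ((stair u x).length : ℤ) ≤ (d + 1) * K := by
  have := length_stairL_le hK (List.finRange (d + 1)) u le_rfl h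
  rwa [List.length_finRange, Nat.cast_add, Nat.cast_one] at this

/-- the staircase from `u` to `x ≥ u` stays in `[u, x]`. [folklore] -/
theorem mem_stair {u x z : Fin (d + 1) → ℤ} (h : u ≤ x) (hz : z ∈ stair u x) : u ≤ z ∧ z ≤ x :=
  mem_stairL _ u le_rfl h z hz

/-- block geometry: if `blk n x = y` then the base corner `n·y` satisfies `n·y ≤ x < n·y + n`. [folklore] -/
theorem base_le_of_blk {n : ℕ} (hn : 1 ≤ n) {x y : Fin (d + 1) → ℤ} (h : blk n x = y) :
    (fun i => (n : ℤ) * y i) ≤ x ∧ ∀ i, x i - n * y i ≤ n := by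
  have hn0 : (0 : ℤ) < n := by exact_mod_cast hn
  have key : ∀ i, (n : ℤ) * y i ≤ x i ∧ x i - n * y i ≤ n := by
    intro i
    have hyi : y i = x i / (n : ℤ) := by rw [← h]; rfl
    have hdiv := Int.mul_ediv_add_emod (x i) (n : ℤ)
    have hr0 := Int.emod_nonneg (x i) hn0.ne'
    have hr1 := Int.emod_lt_of_pos (x i) hn0
    rw [hyi]
    constructor <;> linarith
  exact ⟨fun i => (key i).1, fun i => (key i).2⟩

/-- the base corner `n·y` of a unit block lies in the fine box. [folklore] -/
theorem base_mem_boxDom {n : ℕ} (hn : 1 ≤ n) (M : Fin (d + 1) → ℕ) (y : ↥(boxDom M)) :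
    (fun i => (n : ℤ) * y.1 i) ∈ boxDom (fun i => n * M i) := by
  have hn0 : (0 : ℤ) < n := by exact_mod_cast hn
  have hy := mem_boxDom.1 y.2
  rw [mem_boxDom]
  intro i
  refine ⟨mul_nonneg hn0.le (hy i).1, ?_⟩
  push_cast
  exact mul_lt_mul_of_pos_left (hy i).2 hn0

/-- the base-corner embedding `y ↦ n·y` of the unit lattice into the fine box. [folklore] -/
def baseEmb {n : ℕ} (hn : 1 ≤ n) (M : Fin (d + 1) → ℕ) (y : ↥(boxDom M)) : ↥(boxDom (fun i => n * M i)) :=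
  ⟨fun i => (n : ℤ) * y.1 i, base_mem_boxDom hn M y⟩

/-- the staircase from the base corner of `B(y)` to `x ∈ B(y)` stays inside the fine box. [folklore] -/
theorem stair_mem_boxDom {n : ℕ} (hn : 1 ≤ n) (M : Fin (d + 1) → ℕ) (y : ↥(boxDom M))
    (x : ↥(boxDom (fun i => n * M i))) (h : blk n x.1 = y.1) :
    ∀ z ∈ stair (fun i => (n : ℤ) * y.1 i) x.1, z ∈ boxDom (fun i => n * M i) := fun _ hz =>
  mem_boxDom_of_between (base_mem_boxDom hn M y) x.2 (mem_stair (base_le_of_blk hn h).1 hz).1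
    (mem_stair (base_le_of_blk hn h).1 hz).2

open Classical in
/-- **THE CONTOUR SYSTEM** `Γ_{y,x}` of the fine box: the staircase when `x ∈ B(y)`, empty otherwise.
[cite: Balaban1983RegularityDecay, p. 572 «Γ^{(k)}_{y,x}»] -/
noncomputable def stairContour {n : ℕ} (hn : 1 ≤ n) (M : Fin (d + 1) → ℕ) (y : ↥(boxDom M))
    (x : ↥(boxDom (fun i => n * M i))) : List ↥(boxDom (fun i => n * M i)) :=
  if h : blk n x.1 = y.1 then (stair (fun i => (n : ℤ) * y.1 i) x.1).pmap Subtype.mk (stair_mem_boxDom hn M y x h)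
  else []

/-- a nonzero block weight means `x ∈ B(y)`. [folklore] -/
theorem blkWt_ne_zero {n : ℕ} {M N : Fin (d + 1) → ℕ} {y : ↥(boxDom M)} {x : ↥(boxDom N)}
    (h : blkWt n M N y x ≠ 0) : blk n x.1 = y.1 := by
  unfold blkWt at h
  by_contra hb
  exact h (if_neg hb)

/-- hypothesis `hend` of `lower18_regular_box` for the staircase contours. [folklore] -/
theorem stairContour_end {n : ℕ} (hn : 1 ≤ n) (M : Fin (d + 1) → ℕ) (y : ↥(boxDom M))
    (x : ↥(boxDom (fun i => n * M i))) (h : blkWt n M (fun i => n * M i) y x ≠ 0) :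
    pathEnd (baseEmb hn M y) (stairContour hn M y x) = x := by
  have hb := blkWt_ne_zero h
  rw [stairContour, dif_pos hb]
  apply Subtype.ext
  rw [baseEmb, val_pathEnd_pmap]
  exact pathEnd_stair (base_le_of_blk hn hb).1

/-- hypothesis `hnn` of `lower18_regular_box` for the staircase contours. [folklore] -/
theorem stairContour_nn {n : ℕ} (hn : 1 ≤ n) (M : Fin (d + 1) → ℕ) (y : ↥(boxDom M))
    (x : ↥(boxDom (fun i => n * M i))) :
    PathRel (fun u v : ↥(boxDom (fun i => n * M i)) => v.1 ∈ nbrs u.1) (baseEmb hn M y)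
      (stairContour hn M y x) := by
  unfold stairContour
  split_ifs with hb
  · rw [baseEmb, pathRel_pmap_iff (r := fun u v => v ∈ nbrs u)]
    exact pathRel_stair (base_le_of_blk hn hb).1
  · trivial

/-- hypothesis `hlen` of `lower18_regular_box` for the staircase contours: `|Γ_{y,x}| ≤ (d+1)·n`. [folklore] -/
theorem stairContour_length {n : ℕ} (hn : 1 ≤ n) (M : Fin (d + 1) → ℕ) (y : ↥(boxDom M))
    (x : ↥(boxDom (fun i => n * M i))) : ((stairContour hn M y x).length : ℝ) ≤ (d + 1) * n := by
  unfold stairContour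
  split_ifs with hb
  · rw [List.length_pmap]
    have := length_stair_le (base_le_of_blk hn hb).1 (base_le_of_blk hn hb).2
    exact_mod_cast this
  · simp only [List.length_nil, Nat.cast_zero]; positivity

/-- **(1.8) FOR REGULAR CONFIGURATIONS ON FINE BOXES WITH [B4]'S STAIRCASE CONTOURS** — `lower18_regular_box`
with the contour hypotheses DISCHARGED by the construction above (block averages based at the corner `n·y`).
[cite: Balaban1983RegularityDecay, p. 573 (1.8) with p. 572 (1.4), pp. 579–580 (2.23)–(2.26)] -/
theorem lower18_regular_box_stair {ι : Type*} [Fintype ι] [DecidableEq ι] (F : OrthFlow ι) {ℓ : ℝ} (hℓ : 0 ≤ ℓ)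
    (hLip : ∀ t (v : ι → ℝ), ((F.U t - 1) *ᵥ v) ⬝ᵥ ((F.U t - 1) *ᵥ v) ≤ (ℓ * t) ^ 2 * (v ⬝ᵥ v))
    (κ : ℝ) {n : ℕ} (hn : 1 ≤ n) {a : ℝ} (ha : 0 ≤ a) (m2 : ℝ) (M : Fin (d + 1) → ℕ)
    (A₀ : Fin (d + 1) → ℝ) {A : ↥(boxDom (fun i => n * M i)) → ↥(boxDom (fun i => n * M i)) → ℝ} {θ : ℝ}
    (hθ : 0 ≤ θ) (hA : ∀ x y, y.1 ∈ nbrs x.1 → |κ * (A x y - constBond A₀ Subtype.val x y)| ≤ θ / n)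
    (hsmall : ℓ ^ 2 * θ ^ 2 * (d + 1) * (1 + a * (d + 1)) ≤ min 2 a / 4)
    (Φ : ↥(boxDom (fun i => n * M i)) × ι → ℝ) :
    (min 2 a / 4 + m2) * (Φ ⬝ᵥ Φ)
      ≤ Φ ⬝ᵥ (b4Op F κ (boxWt n (fun i => n * M i)) m2 (a * ((n : ℝ) ^ (d + 1))⁻¹)
          (blkWt n M (fun i => n * M i)) (baseEmb hn M) (stairContour hn M) A *ᵥ Φ) :=
  lower18_regular_box F hℓ hLip κ hn ha m2 M (fun y x h => stairContour_end hn M y x h)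
    (fun y x _ => stairContour_nn hn M y x) (fun y x _ => stairContour_length hn M y x) A₀ hθ hA hsmall Φ

/-- **LEMMA 2.1 (2.15), FIRST MEMBER, ON FINE BOXES FOR REGULAR NON-CONSTANT `A`** (p. 577 (2.15) «‖G_k(□,A)f‖₂,
‖D^η_{A,μ}G_k(□,A)f‖₂, ‖G_k(□,A)D^{η*}_{A,μ}f‖₂, ‖D^η_{A,μ}G_k(□,A)D^{η*}_{A,ν}f‖₂ ≤ c₂‖f‖₂», first member, here
with the explicit `c₂ = (min(2,a)/4 + m²)^{-1}`): the Green's function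
`G_k(□,A) = (−Δ^{η,N}_{A,□} + m² + aP_k(A))^{-1}` exists and `(min(2,a)/4 + m²)²‖G_k(□,A)f‖₂² ≤ ‖f‖₂²`.
[cite: Balaban1983RegularityDecay, Lemma 2.1 (2.15) p. 577, first member, box case] -/
theorem green_box_l2_bound {ι : Type*} [Fintype ι] [DecidableEq ι] (F : OrthFlow ι) {ℓ : ℝ} (hℓ : 0 ≤ ℓ)
    (hLip : ∀ t (v : ι → ℝ), ((F.U t - 1) *ᵥ v) ⬝ᵥ ((F.U t - 1) *ᵥ v) ≤ (ℓ * t) ^ 2 * (v ⬝ᵥ v))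
    (κ : ℝ) {n : ℕ} (hn : 1 ≤ n) {a : ℝ} (ha : 0 ≤ a) {m2 : ℝ} (hpos : 0 < min 2 a / 4 + m2)
    (M : Fin (d + 1) → ℕ) (A₀ : Fin (d + 1) → ℝ)
    {A : ↥(boxDom (fun i => n * M i)) → ↥(boxDom (fun i => n * M i)) → ℝ} {θ : ℝ} (hθ : 0 ≤ θ)
    (hA : ∀ x y, y.1 ∈ nbrs x.1 → |κ * (A x y - constBond A₀ Subtype.val x y)| ≤ θ / n)
    (hsmall : ℓ ^ 2 * θ ^ 2 * (d + 1) * (1 + a * (d + 1)) ≤ min 2 a / 4)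
    (f : ↥(boxDom (fun i => n * M i)) × ι → ℝ) :
    IsUnit (b4Op F κ (boxWt n (fun i => n * M i)) m2 (a * ((n : ℝ) ^ (d + 1))⁻¹)
        (blkWt n M (fun i => n * M i)) (baseEmb hn M) (stairContour hn M) A).det ∧
      (min 2 a / 4 + m2) ^ 2
          * (((b4Op F κ (boxWt n (fun i => n * M i)) m2 (a * ((n : ℝ) ^ (d + 1))⁻¹)
                (blkWt n M (fun i => n * M i)) (baseEmb hn M) (stairContour hn M) A)⁻¹ *ᵥ f) ⬝ᵥ
            ((b4Op F κ (boxWt n (fun i => n * M i)) m2 (a * ((n : ℝ) ^ (d + 1))⁻¹)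
                (blkWt n M (fun i => n * M i)) (baseEmb hn M) (stairContour hn M) A)⁻¹ *ᵥ f))
        ≤ f ⬝ᵥ f :=
  ⟨isUnit_det_of_form_ge hpos (lower18_regular_box_stair F hℓ hLip κ hn ha m2 M A₀ hθ hA hsmall),
    inv_mulVec_sq_le hpos (lower18_regular_box_stair F hℓ hLip κ hn ha m2 M A₀ hθ hA hsmall) f⟩

end Stair

section Family

/-! ## §9 THE TYPED (1.8) `B4.Claim18Printed` ON THE REGULAR-BOX FAMILY (`A ≠ 0`)

`B4.Claim18Printed fam := ∃ γ₀ e₁ > 0, ∀ i, (fam i).regular → 0 < (fam i).e → (fam i).e ≤ e₁ → (fam i).lower18 γ₀`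
reads three fields of the free carrier `B4.EtaSetting`.  The family below is indexed by
`(n, M, e, A₀, A)` — scale, unit box, CHARGE (the instance's own coordinate), constant background, configuration —
with `regular` := the (2.23)-form regularity `|A_b − A₀(b)| ≤ c'e^{β−1}` on nearest-neighbour bonds and
`lower18 γ` := the form inequality for [B4]'s operator at `A` with `κ = e/n`, staircase contours, mass `0`.
The 23 fields of `EtaSetting` that (1.8) does not read (distances, norms other than `‖·‖₂`, (1.9)–(1.12) data) are
NOT modelled (set to `0` / `True`): this family certifies (1.8) ONLY. -/

open Literature.MathematicalPhysics.QuantumFieldTheory.Balaban1983to89.B4 (EtaSetting Claim18Printed)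
open Literature.MathematicalPhysics.QuantumFieldTheory.Balaban1983to89.B4Reflection242 (boxDom nbrs blk)

variable {ι : Type} {d : ℕ}

/-- AN INSTANCE of the regular-box family: scale `n = L^k ≥ 1` (fine points per unit length), unit box
`Π_μ[0, M_μ)`, charge `e`, constant background `A₀`, configuration `A` on the bonds of the fine box — NO hypothesis
(regularity is the family's `regular` predicate, smallness of `e` the threshold of (1.8)). [folklore] -/
structure RegularBoxInstance (d : ℕ) where
  n : ℕ
  hn : 1 ≤ n
  M : Fin (d + 1) → ℕ
  e : ℝ
  A₀ : Fin (d + 1) → ℝ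
  A : ↥(boxDom (fun i => n * M i)) → ↥(boxDom (fun i => n * M i)) → ℝ

/-- THE REGULAR-BOX CARRIER of `B4.EtaSetting` (flow `F`, i.e. `N` and `q`, and the constants `a, c', β` are family
parameters).  `e` := the instance's charge; `regular` := `|A'| ≤ c'e^{β−1}` ((2.23) «|A'|, |∂^η_μA'| ≤ c'e^{β−1}», first member) for `A' = A − A₀` on
nearest-neighbour bonds; `lower18 γ` := `∀ Φ, γ|Φ|² ≤ ⟨Φ, (−Δ^{η,N}_{A,□} + a_kP_k(A))Φ⟩` with `U = F.U((e/n)·)`,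
`a_k = a·n^{-(d+1)}`, staircase contours; every other field is a placeholder (`0` / `True`) not read by (1.8).
[cite: Balaban1983RegularityDecay, (1.7)–(1.8) p. 573 with (2.23) p. 579] -/
noncomputable def regularBoxSetting [Fintype ι] [DecidableEq ι] (F : OrthFlow ι) (a c' β : ℝ)
    (i : RegularBoxInstance d) : EtaSetting where
  Site := ↥(boxDom (fun j => i.n * i.M j)) × ι
  Dir := Fin (d + 1)
  Src := ↥(boxDom (fun j => i.n * i.M j)) × ι → ℝ
  e := i.e
  regular := ∀ x y : ↥(boxDom (fun j => i.n * i.M j)), y.1 ∈ nbrs x.1 →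
    |i.A x y - constBond i.A₀ Subtype.val x y| ≤ c' * i.e ^ (β - 1)
  bigBlocks := True
  rect := True
  pdist := fun _ _ => 0
  sdist1 := fun _ _ => 0
  sdist2 := fun _ _ _ => 0
  bdist1 := fun _ => 0
  bdist2 := fun _ _ => 0
  bdistS := fun _ => 0
  supNorm := fun _ => 0
  l2Norm := fun f => Real.sqrt (f ⬝ᵥ f)
  ssdist := fun _ _ => 0
  lhs19 := fun _ _ _ _ _ => 0
  valDG := fun _ _ _ => 0
  valG := fun _ _ => 0
  dlhs19 := fun _ _ _ _ _ => 0
  dvalDG := fun _ _ _ => 0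
  dvalG := fun _ _ => 0
  lower18 := fun γ => ∀ Φ : ↥(boxDom (fun j => i.n * i.M j)) × ι → ℝ,
    γ * (Φ ⬝ᵥ Φ) ≤ Φ ⬝ᵥ (b4Op F (i.e / i.n) (boxWt i.n (fun j => i.n * i.M j)) 0
      (a * ((i.n : ℝ) ^ (d + 1))⁻¹) (blkWt i.n i.M (fun j => i.n * i.M j)) (baseEmb i.hn i.M)
      (stairContour i.hn i.M) i.A *ᵥ Φ)
  pair := fun _ _ _ _ _ => 0
  dpair := fun _ _ _ _ _ => 0

/-- the carrier's charge is the instance's coordinate. [folklore] -/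
theorem regularBoxSetting_e [Fintype ι] [DecidableEq ι] (F : OrthFlow ι) (a c' β : ℝ) (i : RegularBoxInstance d) :
    (regularBoxSetting F a c' β i).e = i.e := rfl

/-- the carrier's `regular` reads: `|A_b − A₀(b)| ≤ c'e^{β−1}` on nearest-neighbour bonds. [folklore] -/
theorem regularBoxSetting_regular_iff [Fintype ι] [DecidableEq ι] (F : OrthFlow ι) (a c' β : ℝ)
    (i : RegularBoxInstance d) : (regularBoxSetting F a c' β i).regular ↔
      ∀ x y : ↥(boxDom (fun j => i.n * i.M j)), y.1 ∈ nbrs x.1 →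
        |i.A x y - constBond i.A₀ Subtype.val x y| ≤ c' * i.e ^ (β - 1) :=
  Iff.rfl

/-- the carrier's `lower18 γ` reads: `∀ Φ, γ|Φ|² ≤ ⟨Φ, H_{A}(m² = 0)Φ⟩` with `κ = e/n`. [folklore] -/
theorem regularBoxSetting_lower18_iff [Fintype ι] [DecidableEq ι] (F : OrthFlow ι) (a c' β : ℝ)
    (i : RegularBoxInstance d) (γ : ℝ) : (regularBoxSetting F a c' β i).lower18 γ ↔
      ∀ Φ : ↥(boxDom (fun j => i.n * i.M j)) × ι → ℝ,
        γ * (Φ ⬝ᵥ Φ) ≤ Φ ⬝ᵥ (b4Op F (i.e / i.n) (boxWt i.n (fun j => i.n * i.M j)) 0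
          (a * ((i.n : ℝ) ^ (d + 1))⁻¹) (blkWt i.n i.M (fun j => i.n * i.M j)) (baseEmb i.hn i.M)
          (stairContour i.hn i.M) i.A *ᵥ Φ) :=
  Iff.rfl

/-- **THEOREM ((1.8) TYPED, ON THE REGULAR-BOX FAMILY WITH NON-CONSTANT FIELDS)**: for a Lipschitz orthogonal
flow (`|(U(t) − 1)v| ≤ ℓ|t||v|`), `a > 0`, `c' ≥ 0`, `β > 0`, the printed claim `B4.Claim18Printed` — «there
exists a positive constant γ₀ such that for e sufficiently small and for a regular vector field A (1.8)
−Δ^{η,N}_{A,Ω} + aP_k(A) ≥ γ₀ I.» — HOLDS on the family `regularBoxSetting F a c' β` of ALL fine boxes, scales,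
charges, constant backgrounds and configurations, with the witnesses `γ₀ = min(2,a)/4` and the explicit `e₁` of
`threshold_exists`.  HONEST LABEL: box regions only (not general unions of big blocks `Ω`); regularity in the
(2.23) form about a constant background. [cite: Balaban1983RegularityDecay, p. 573 (1.8)] -/
theorem claim18Printed_regularBox [Fintype ι] [DecidableEq ι] (F : OrthFlow ι) {ℓ : ℝ} (hℓ : 0 ≤ ℓ)
    (hLip : ∀ t (v : ι → ℝ), ((F.U t - 1) *ᵥ v) ⬝ᵥ ((F.U t - 1) *ᵥ v) ≤ (ℓ * t) ^ 2 * (v ⬝ᵥ v))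
    {a : ℝ} (ha : 0 < a) {c' : ℝ} (hc' : 0 ≤ c') {β : ℝ} (hβ : 0 < β) :
    Claim18Printed (regularBoxSetting (d := d) F a c' β) := by
  obtain ⟨e₁, he₁, hsm⟩ := threshold_exists ℓ c' ha hβ d
  refine ⟨min 2 a / 4, e₁, div_pos (lt_min two_pos ha) four_pos, he₁, ?_⟩
  intro i hreg he hle Φ
  change 0 < i.e at he
  change i.e ≤ e₁ at hle
  have h := lower18_regular_box_charge F hℓ hLip he i.hn ha.le 0 i.M
    (fun y x h => stairContour_end i.hn i.M y x h) (fun y x _ => stairContour_nn i.hn i.M y x)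
    (fun y x _ => stairContour_length i.hn i.M y x) i.A₀ hc' hreg (hsm i.e he hle) Φ
  simpa only [add_zero] using h

/-- (1.8) typed on the regular-box family for the ROTATION FLOW (`N = 2`, `ℓ = 1`): a hypothesis-free instance of
the flow assumptions. [cite: Balaban1983RegularityDecay, p. 573 (1.8)] -/
theorem claim18Printed_regularBox_rot {a : ℝ} (ha : 0 < a) {c' : ℝ} (hc' : 0 ≤ c') {β : ℝ} (hβ : 0 < β) :
    Claim18Printed (regularBoxSetting (d := d) OrthFlow.rot a c' β) :=
  claim18Printed_regularBox OrthFlow.rot zero_le_one rot_lipschitz ha hc' hβ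

end Family

end Literature.MathematicalPhysics.QuantumFieldTheory.Balaban1983to89.B4Lower18Regular
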